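import Literature.NumberTheory.DiophantineGeometry.BcgpSerreRegularWeightAbelianSurfacesModular
import Literature.NumberTheory.DiophantineGeometry.BcgpSerreWreathReductionImprimitiveSurfaces
import Literature.NumberTheory.DiophantineGeometry.BcgpSerreWreathFixedSimilitudeImprimitiveSurfaces
import Literature.NumberTheory.DiophantineGeometry.AVIsogenyTateHoldsProofs
import Literature.NumberTheory.DiophantineGeometry.AVGaloisModuleContinuityProofs
import Literature.AlgebraicGeometry.Motives.TateAbelianFiniteSteps
import Literature.NumberTheory.EllipticCurves.TateModuleFixedPointsProofs
import Mathlib.RepresentationTheory.Irreducible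
import Mathlib.RingTheory.TensorProduct.Free
import HarnessLib

/-!
# `bcgp_serreRegularWeight_implies_allAbelianSurfacesModular`: the imprimitive sector is the wreath
# fact, through a Faltings-free "irreducible `H¹` ⟹ `End(A) = ℤ`" (proofs)

Topic `NumberTheory/DiophantineGeometry`; `…Proofs` companion (theorems only: no definition, no named
fact, no `sorry`) of `BcgpSerreRegularWeightAbelianSurfacesModular`, landed by the provefact seat of
the named fact `Literature.NumberTheory.DiophantineGeometry.bcgp_serreRegularWeight_implies_allAbelianSurfacesModular`
(G. Boxer, F. Calegari, T. Gee, V. Pilloni, *Modularity theorems for abelian surfaces*,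
arXiv:2502.20645 (2025), Lemma 10.4.1 with Remark 10.4.2, Theorem 10.2.1, Definition 1.8.12).

## What is proved

Write `F` for the fact (`H → C`: "Serre's conjecture for `GSp₄/ℚ` in regular ordinary weight, `GL₄`
proxy" ⟹ "every abelian surface `A/ℚ` with irreducible `H¹_ét(A_ℚ̄, ℚ̄_ℓ)` is modular") and `W` for
the sibling fact `bcgp_serreWreath_implies_quadraticImprimitiveSurfacesModular` (the same printed
lemma along its proof for Galois type **B**[C₂], p. 146, + Theorem 10.2.1: the hypothesis `H`
sharpened to the wreath residues ⟹ every surface with `End_ℚ(A) = ℤ` whose `H¹` becomes reducible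
over a quadratic field is modular).

1. `AbelianVariety.forall_end_eq_zsmul_id_of_isIrreducible_dualFrame` — **for an abelian variety
   `A` over ANY field `K`, a prime `ℓ` invertible in `K`, a `ℚ_ℓ`-basis `b` of `V_ℓ A` and the framed
   `r : Γ_K → GL_d(ℚ̄_ℓ)`, `r(g) = [g⁻¹]_bᵀ ⊗ ℚ̄_ℓ` (the representation on `H¹ = (V_ℓ A)^∨ ⊗ ℚ̄_ℓ`, the
   frame clause of `F`, `W` and `bcgp_switch_exists_modular_abelianSurface`): if `r` is irreducible
   then `End_K(A) = ℤ · 𝟙`.** This is the Faltings-FREE direction of "`End_ℚ(A) = ℤ` ⟺ `H¹`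
   absolutely irreducible" (the converse, used route-side in
   `Summits/…/AbelianSurfaceSerreQuadraticImprimitiveSurfacesOfOrdinarySerre`, needs Faltings' Satz 3–4,
   unproved in the tree). Printed: Mumford, *Abelian Varieties*, §19, Theorem 3 (`End(A)` is a free
   finitely generated `ℤ`-module and `ℤ_ℓ ⊗ End(A) → End(T_ℓ A)` is injective) — PROVED in the tree
   (`module_free_hom_holds`, `faltingsTateMap_injective_holds`, `module_free_tateModule_holds`,
   `TateModule.toRational_injective`) — and Schur's lemma over `ℚ̄_ℓ` (Mathlib
   `Representation.IsIrreducible.algebraMap_intertwiningMap_bijective_of_isAlgClosed`). Chain: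
   * `exists_eq_smul_one_of_forall_mul_eq_mul_of_isIrreducible` (Schur for matrix groups over an
     algebraically closed field: a matrix commuting with an irreducible `G →* GL_n(k)` is scalar);
   * `AbelianVariety.exists_rationalTateModuleMap_eq_smul_id_of_isIrreducible_dualFrame`
     (`V_ℓ f = c · id`, `c ∈ ℚ_ℓ`, for every `f ∈ End_K(A)`: `[V_ℓ f]_b` commutes with `[g]_b`, hence
     its transpose over `ℚ̄_ℓ` with `r`);
   * `AbelianVariety.exists_forall_tateModuleMap_eq_smul_of_rationalTateModuleMap_eq_smul_id`
     (`T_ℓ f = a · id`, `a ∈ ℤ_ℓ`: read `c` off a `ℤ_ℓ`-basis of the free `T_ℓ A` inside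
     `V_ℓ A = ℚ_ℓ ⊗ T_ℓ A`, `T_ℓ A ↪ V_ℓ A`);
   * `AbelianVariety.forall_end_eq_zsmul_id_of_forall_tateModuleMap_eq_smul` (the lattice argument:
     if two elements `f₁, f₂` of a `ℤ`-basis of `End(A)` act on `T_ℓ A ≠ 0` by `a₁, a₂ ∈ ℤ_ℓ` then
     `a₂ ⊗ f₁ - a₁ ⊗ f₂` dies under the injective Tate map, so the basis has one element `g`, and
     `𝟙 = k g`, `g ∘ g = m g` with `k m = 1` force `g = ±𝟙`).
2. `bcgp_serreRegularWeight_implies_allAbelianSurfacesModular_of_wreath_of_primitive` — **`F` from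
   `W` and the quadratically PRIMITIVE slice of `F`** (the hypothesis `H` of `F`, verbatim, ⟹
   modularity of the surfaces with irreducible `H¹` that stays irreducible over every quadratic field;
   in print: the proof of Lemma 10.4.1 for type **A**, p. 146, + Theorem 10.2.1; stated INLINE as a
   hypothesis, no definition): split on quadratic imprimitivity of `r`; the imprimitive surfaces have
   `End_ℚ(A) = ℤ` by (1), `H` restricts to the wreath residues by pure logic (the route-side stub
   `stub_serreWreath_of_ordinarySerre`, re-derived inline), and `W` applies. So in the tree `F` is
   EXACTLY `W` ⊕ (type-**A**/primitive slice): the debt of `F` beyond `W` is that slice alone.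
3. Part 3 (appended): the PINNED-multiplier hypothesis bracket (`∃ m : ℕ`, multiplier
   `ε_p^{-(1+2(p-1)m)}`; the faithful clause of `## Status` below) written out and elaborated, with the
   pure-logic comparisons `ordinarySerre_of_ordinarySerrePinned` (pinned ⟹ present hypothesis) and
   `bcgp_serreRegularWeightPinned_implies_allAbelianSurfacesModular_of` (present fact ⟹ its pinned
   variant) — no definition, no named fact; for the planner who restates the route bracket.
4. Part 4 (appended): the corrected statements in their final typed form. `## Review 2` of the fact's
   module docstring (misstated on BOTH sectors) types the corrected hypothesis with the clause
   `∃ s, p - 1 ∣ s ∧ multiplier ε_p^{-(1+2s)}` — verbatim the clause of the corrected wreath fact, now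
   NAMED `bcgp_serreWreathFixedSimilitude_implies_quadraticImprimitiveSurfacesModular` — and proves
   the corrected implication's conclusion type from `F`. Proved here: that form ↔ Part 3's pinned form
   (`exists_dvd_isSymplectic_cyclotomicPow_iff`, `ordinarySerreFixedSimilitude_iff_ordinarySerrePinned`,
   `serreToAbelianSurfacesFixedSimilitude_iff_pinned`); the corrected hypothesis restricts to the
   wreath residues (`serreWreathFixedSimilitude_of_ordinarySerreFixedSimilitude`); and (2) carries
   over word for word — **corrected implication = corrected wreath fact ⊕ primitive slice**
   (`bcgp_serreRegularWeightFixedSimilitude_of_wreathFixedSimilitude_of_primitive`).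

## Status of the fact recorded by this seat (2026-08-17, session 4)

* SIZE XL and conditional in print on the twisted weighted fundamental lemma (BCGP §1.6) — see the
  module docstring of the fact.
* MISSTATED ON THE IMPRIMITIVE SECTOR (concurring with `## Review` in the fact's module docstring,
  verified independently by this seat): for an imprimitive residue `ρ̄ = Ind_{Γ_K}^{Γ_ℚ} σ̄`
  (`ρ̄|Γ_K = σ̄₁ ⊕ σ̄₂`, `σ̄₁ ≇ σ̄₂`, `det σ̄ᵢ = ε̄⁻¹`) the `Γ_K`-invariant forms are `aJ₁ ⊥ bJ₂` and
  `w ∉ Γ_K` imposes one condition with the two solutions `χ(w) = ±√(ε̄⁻¹(w²))`, i.e. TWO symplectic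
  structures, of multipliers `ε̄⁻¹` and `ε̄⁻¹ η̄_K`; the typed hypothesis output
  `∃ μ, r.IsSymplecticWithMultiplierFun μ` lets the witness `(Π, r)` sit in the `η̄_K`-class, whose
  descent to `GSp₄` has central character of finite part `η_K`, consumed by NO statement of the source
  (central character `|·|²` throughout, p. 9). So on type **B**[C₂] — inside the second bracket — `F`
  (and `W`) are stronger than Lemma 10.4.1 ∘ (published results). By (2) this defect of `F` is
  confined to `W`'s sector. FAITHFUL OUTPUT CLAUSE (this seat's refinement of the review's proposal,
  for the planner who owns the verbatim route bracket `OrdinarySerreGSp4`): pin the multiplier to a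
  pure cyclotomic power from which the printed `π` (central character `|·|²`, level prime to `p`,
  `ρ̄_{π,p} ≅ ρ̄`) is recovered by an `|ν|^m`-twist WITHOUT moving `ρ̄` — `∃ m : ℕ,
  r.IsSymplecticWithMultiplierFun (fun g ↦ (ε_p g)⁻¹ ^ (1 + 2 (p - 1) m))`; conversely the printed `π`
  of weight `(k, l; 2)` gives such a witness by `r := ρ_{π,p} ⊗ ε^{-(p-1)m}`, `Π := transfer(π) ⊗
  |det|^{-(p-1)m}` with `(p - 1) m ≥ (k + l)/2 - 2` (the ℕ-valued injective ordinary shape becomes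
  `((k+l)/2 - 1 + (p-1)m, (p-1)m - (k-l)/2, (p-1)m + (k-l)/2 + 1, (p-1)m + 2 - (k+l)/2)` and the
  Frobenius congruence is unchanged as `q^{(p-1)m} ≡ 1 mod p`). No corrected fact is vended here: the
  bracket is verbatim a route definition applied by two `Summits` modules, so the restatement is made
  route-side first and the fact re-vended against it (as `## Review` rules); this file's theorem (1) is
  bracket-independent and (2) stays a theorem about the present names.
* UPDATE (session 5, after `## Review 2` of the fact's module docstring): the over-claim is on BOTH
  sectors — besides the similitude class, an `∃ μ` witness of odd Tate parity (`μ|_{I_p} = ε^{-(1+2s)}`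
  with `p - 1 ∤ s`) certifies the printed hypothesis at `ρ̄ ⊗ η̄_p` (`η̄_p = ε̄^{(p-1)/2}`), not at `ρ̄`,
  at type **A** residues too; this seat re-derived the point and concurs (its pinned clause above has
  `s = (p-1)m`, even parity, built in). The corrected implication is typed in the fact file
  (`bcgp_serreRegularWeightFixedSimilitude_implies_allAbelianSurfacesModular_of_serreRegularWeight`,
  conclusion type) and decomposed in Part 4 below; naming it is a definition proposal of the route's
  planner / line lead (as was done for the wreath fact), not of this proving seat (D-0026).
* UPDATE (verdict clean-up, defact-verdict seat, 2026-08-17): the fact `F` is now a `@[deprecated]`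
  RECORD in its own file (misstated; body and name kept because a `Summits` module applies it), no
  longer literature debt; the corrected statement is carried there by the live theorem
  `…FixedSimilitude…_of_serreRegularWeight` and here by Part 4, its name as a fact
  (`bcgp_serreRegularWeightFixedSimilitude_implies_allAbelianSurfacesModular`) being reserved for a
  route-side definition proposal. Accordingly the two theorems of this file that are ABOUT the record
  — Part 2's `bcgp_serreRegularWeight_implies_allAbelianSurfacesModular_of_wreath_of_primitive`
  (conclusion = the record) and Part 3's `bcgp_serreRegularWeightPinned_implies_allAbelianSurfacesModular_of`
  (hypothesis = the record) — are deprecated with it, in favour of their Part-4 twins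
  `bcgp_serreRegularWeightFixedSimilitude_of_wreathFixedSimilitude_of_primitive` and
  `serreToAbelianSurfacesFixedSimilitude_iff_pinned`; statements and proofs are unchanged. Part 1
  (bracket-independent) and the rest of Parts 3–4 are unaffected.

## References

* [BoxerCalegariGeePilloni2025] G. Boxer, F. Calegari, T. Gee, V. Pilloni, *Modularity theorems for
  abelian surfaces*, arXiv:2502.20645: Lemma 10.4.1, Remark 10.4.2 and proof p. 146; Theorem 10.2.1
  (p. 138); Definition 1.8.12; §1.8.9 (p. 9: central character `|·|²`, `ν ∘ ρ_{π,p} = ε⁻¹`).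
* [MumfordAV1970] D. Mumford, *Abelian Varieties*, §19, Theorem 3 with Cor. 1 (pp. 176–178).
* [Faltings1983Endlichkeit] G. Faltings, Invent. Math. 73 (1983), §5 Satz 3–4 (the converse direction,
  not used here).

## Design

Pure theorems in the file's path namespace (the abelian-variety lemmas as `_root_.…AbelianVariety.…`
dot-lemmas, like the `…Proofs` companions of `bcgp_switch_exists_modular_abelianSurface`); axioms
`propext`, `Classical.choice`, `Quot.sound`. Mathlib: `Representation.IsIrreducible` /
`IntertwiningMap` (Schur: `algebraMap_intertwiningMap_bijective_of_isAlgClosed`),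
`Algebra.TensorProduct.basis` (coordinates in `ℚ_ℓ ⊗ T_ℓ` and `ℤ_ℓ ⊗ End`), `Module.Free.chooseBasis`,
`smul_eq_zero_iff_right` (`ℤ_ℓ` a domain, free modules torsion-free).
-/

noncomputable section

open scoped Matrix NumberField TensorProduct
open CategoryTheory IsDedekindDomain
open Literature.NumberTheory.GaloisRepresentations Literature.NumberTheory.Automorphic
open Literature.AlgebraicGeometry.Motives (AbelianVariety)
open Literature.AlgebraicGeometry.Motives.AbelianVariety
open Literature.NumberTheory.EllipticCurves

universe u

namespace Literature.NumberTheory.DiophantineGeometry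

/-! ## Part 1. Schur for matrix groups and "irreducible `H¹` ⟹ `End(A) = ℤ`" -/

section Schur

/-- **Schur's lemma for a matrix group over an algebraically closed field.** If `r : G →* GL_n(k)`,
`k` algebraically closed, is irreducible on `kⁿ` (Mathlib `Representation.IsIrreducible` of the
standard representation composed with `r`) and `M` commutes with every `r g`, then `M` is scalar:
the intertwining operator `v ↦ M v` is `c · id` by Mathlib's
`Representation.IsIrreducible.algebraMap_intertwiningMap_bijective_of_isAlgClosed` (Schur), and
`Matrix.toLin'` is injective. [folklore] -/
theorem exists_eq_smul_one_of_forall_mul_eq_mul_of_isIrreducible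
    {k : Type*} [Field k] [IsAlgClosed k] {G : Type*} [Group G] {n : ℕ}
    (r : G →* GL (Fin n) k)
    (hirr : Representation.IsIrreducible ((glStdRepresentation (Fin n) k).comp r))
    (M : Matrix (Fin n) (Fin n) k)
    (hM : ∀ g : G, M * (r g : Matrix (Fin n) (Fin n) k) = (r g : Matrix (Fin n) (Fin n) k) * M) :
    ∃ c : k, M = c • (1 : Matrix (Fin n) (Fin n) k) := by
  set ρ : Representation k G (Fin n → k) := (glStdRepresentation (Fin n) k).comp r with hρ
  haveI : ρ.IsIrreducible := hirr
  let φ : ρ.IntertwiningMap ρ :=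
    (Matrix.toLin' M).intertwiningMap_of_isIntertwiningMap ρ ρ (fun g v => by
      change M *ᵥ ((r g : Matrix (Fin n) (Fin n) k) *ᵥ v) =
        (r g : Matrix (Fin n) (Fin n) k) *ᵥ (M *ᵥ v)
      rw [Matrix.mulVec_mulVec, Matrix.mulVec_mulVec, hM g])
  obtain ⟨c, hc⟩ :=
    (Representation.IsIrreducible.algebraMap_intertwiningMap_bijective_of_isAlgClosed (ρ := ρ)).2 φ
  refine ⟨c, ?_⟩
  have h1 : (algebraMap k (ρ.IntertwiningMap ρ) c).toLinearMap = Matrix.toLin' M := by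
    rw [hc]; rfl
  rw [Representation.IntertwiningMap.algebraMap_apply,
    Representation.IntertwiningMap.toLinearMap_smul] at h1
  have h2 : Matrix.toLin' M = Matrix.toLin' (c • (1 : Matrix (Fin n) (Fin n) k)) := by
    rw [map_smul, Matrix.toLin'_one, ← h1]; rfl
  exact Matrix.toLin'.injective h2

variable {K : Type u} [Field K]

/-- **`V_ℓ f` is a scalar when `H¹ ⊗ ℚ̄_ℓ` is irreducible.** For an abelian variety `A/K`, a prime
`ℓ`, a `ℚ_ℓ`-basis `b` of `V_ℓ A`, the framed `r : Γ_K → GL_d(ℚ̄_ℓ)` with `r(g) = [g⁻¹]_bᵀ ⊗ ℚ̄_ℓ`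
(the representation on `(V_ℓ A)^∨ ⊗ ℚ̄_ℓ` in the dual basis) irreducible, and `f ∈ End_K(A)`:
`V_ℓ f = c · id` for some `c ∈ ℚ_ℓ`. Indeed `[V_ℓ f]_b` commutes with every `[g]_b` (`V_ℓ f` is
`Γ_K`-equivariant, `rationalTateRep_rationalTateModuleMap`), so its transpose over `ℚ̄_ℓ` commutes
with every `r g` and is scalar by Schur (`exists_eq_smul_one_of_forall_mul_eq_mul_of_isIrreducible`);
the scalar lies in `ℚ_ℓ` (a diagonal entry) and `LinearMap.toMatrix b b` is injective. Mumford §19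
(p. 176: `End(A) → End_Γ(T_ℓ A)`); Schur. [cite: MumfordAV1970, §19 Thm. 3 (p. 176)] -/
theorem _root_.Literature.AlgebraicGeometry.Motives.AbelianVariety.exists_rationalTateModuleMap_eq_smul_id_of_isIrreducible_dualFrame
    (A : AbelianVariety K) (ℓ : ℕ) [Fact ℓ.Prime] {d : ℕ}
    (b : Module.Basis (Fin d) ℚ_[ℓ] (A.rationalTateModule ℓ))
    (r : FramedGaloisRep K (PadicAlgCl ℓ) d)
    (hr : ∀ g : Field.absoluteGaloisGroup K,
      (r g).val = ((LinearMap.toMatrix b b (A.rationalTateRep ℓ g⁻¹)).map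
        (algebraMap ℚ_[ℓ] (PadicAlgCl ℓ))).transpose)
    (hirr : r.toGaloisRep.IsIrreducible) (f : A ⟶ A) :
    ∃ c : ℚ_[ℓ], rationalTateModuleMap ℓ f = c • LinearMap.id := by
  classical
  set alg := algebraMap ℚ_[ℓ] (PadicAlgCl ℓ) with halg
  set N : Matrix (Fin d) (Fin d) ℚ_[ℓ] := LinearMap.toMatrix b b (rationalTateModuleMap ℓ f) with hN
  -- `N` commutes with the matrices of the Galois action
  have hcomm : ∀ g : Field.absoluteGaloisGroup K,
      N * LinearMap.toMatrix b b (A.rationalTateRep ℓ g) =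
        LinearMap.toMatrix b b (A.rationalTateRep ℓ g) * N := by
    intro g
    rw [hN, ← LinearMap.toMatrix_mul, ← LinearMap.toMatrix_mul]
    congr 1
    exact LinearMap.ext fun v => rationalTateRep_rationalTateModuleMap ℓ f g v
  -- hence `(N.map alg)ᵀ` commutes with every `r g`
  have hcomm' : ∀ g : Field.absoluteGaloisGroup K,
      (N.map alg)ᵀ * (r g : Matrix (Fin d) (Fin d) (PadicAlgCl ℓ)) =
        (r g : Matrix (Fin d) (Fin d) (PadicAlgCl ℓ)) * (N.map alg)ᵀ := by
    intro g
    have h := hcomm g⁻¹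
    change (N.map alg)ᵀ * (r g).val = (r g).val * (N.map alg)ᵀ
    rw [hr g, ← Matrix.transpose_mul, ← Matrix.transpose_mul, ← Matrix.map_mul, ← Matrix.map_mul,
      h]
  obtain ⟨c', hc'⟩ := exists_eq_smul_one_of_forall_mul_eq_mul_of_isIrreducible r.toMonoidHom hirr
    ((N.map alg)ᵀ) hcomm'
  -- so `N.map alg = c' • 1`
  have hN' : N.map alg = c' • (1 : Matrix (Fin d) (Fin d) (PadicAlgCl ℓ)) := by
    have := congrArg Matrix.transpose hc'
    rwa [Matrix.transpose_transpose, Matrix.transpose_smul, Matrix.transpose_one] at this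
  -- read off a scalar `c ∈ ℚ_ℓ` with `N = c • 1`
  have hNc : ∃ c : ℚ_[ℓ], N = c • (1 : Matrix (Fin d) (Fin d) ℚ_[ℓ]) := by
    rcases Nat.eq_zero_or_pos d with hd | hd
    · subst hd
      exact ⟨0, Subsingleton.elim _ _⟩
    · set i₀ : Fin d := ⟨0, hd⟩
      refine ⟨N i₀ i₀, ?_⟩
      have hdiag : ∀ i : Fin d, alg (N i i) = c' := fun i => by
        have := congrFun (congrFun hN' i) i
        simpa [Matrix.map_apply, Matrix.smul_apply, Matrix.one_apply_eq] using this
      ext i j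
      by_cases hij : i = j
      · subst hij
        have h1 : alg (N i i) = alg (N i₀ i₀) := by rw [hdiag i, hdiag i₀]
        simpa [Matrix.smul_apply, Matrix.one_apply_eq] using alg.injective h1
      · have := congrFun (congrFun hN' i) j
        have h0 : alg (N i j) = 0 := by
          simpa [Matrix.map_apply, Matrix.smul_apply, Matrix.one_apply_ne hij] using this
        have : N i j = 0 := by
          rw [← map_zero alg] at h0
          exact alg.injective h0
        simp [Matrix.smul_apply, Matrix.one_apply_ne hij, this]
  obtain ⟨c, hc⟩ := hNc
  refine ⟨c, (LinearMap.toMatrix b b).injective ?_⟩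
  rw [← hN, hc, map_smul, LinearMap.toMatrix_id]

/-- **From `V_ℓ f = c · id` to `T_ℓ f = a · id` with `a ∈ ℤ_ℓ`** (`ℓ` invertible in `K`): `T_ℓ A` is a
free `ℤ_ℓ`-module (`module_free_tateModule_holds`, Mumford §19 p. 171) and embeds in
`V_ℓ A = ℚ_ℓ ⊗ T_ℓ A` (`TateModule.toRational_injective`); reading the identity
`1 ⊗ T_ℓ f (e_i) = c · (1 ⊗ e_i)` in the `ℚ_ℓ`-basis `1 ⊗ e_i` (`Algebra.TensorProduct.basis`) gives
`c = a ∈ ℤ_ℓ`, a coordinate of `T_ℓ f (e_i)`. (If `T_ℓ A = 0` any `a` works.) Mumford §19, pp. 171–172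
(`T_ℓ`, `V_ℓ = T_ℓ ⊗ ℚ_ℓ`). [cite: MumfordAV1970, §19 pp. 171–172] -/
theorem _root_.Literature.AlgebraicGeometry.Motives.AbelianVariety.exists_forall_tateModuleMap_eq_smul_of_rationalTateModuleMap_eq_smul_id
    (A : AbelianVariety K) (ℓ : ℕ) [Fact ℓ.Prime] (hℓ : (ℓ : K) ≠ 0) (f : A ⟶ A) {c : ℚ_[ℓ]}
    (hc : rationalTateModuleMap ℓ f = c • LinearMap.id) :
    ∃ a : ℤ_[ℓ], ∀ x : A.tateModule ℓ, tateModuleMap ℓ f x = a • x := by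
  haveI : Module.Free ℤ_[ℓ] (A.tateModule ℓ) := module_free_tateModule_holds A ℓ hℓ
  set bT := Module.Free.chooseBasis ℤ_[ℓ] (A.tateModule ℓ) with hbT
  -- the key identity `1 ⊗ T_ℓ f x = c • (1 ⊗ x)` in `V_ℓ A = ℚ_ℓ ⊗ T_ℓ A`
  have key : ∀ x : A.tateModule ℓ,
      TateModule.toRational ℓ (tateModuleMap ℓ f x) = c • TateModule.toRational ℓ x := fun x => by
    rw [← rationalTateModuleMap_toRational, hc]
    rfl
  rcases isEmpty_or_nonempty (Module.Free.ChooseBasisIndex ℤ_[ℓ] (A.tateModule ℓ)) with hι | ⟨⟨i₀⟩⟩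
  · -- empty basis: `T_ℓ A = 0`
    haveI : Subsingleton (A.tateModule ℓ) := bT.repr.toEquiv.subsingleton
    exact ⟨0, fun x => Subsingleton.elim _ _⟩
  · -- read off `c = algebraMap ℤ_ℓ ℚ_ℓ a` from the coordinate of `1 ⊗ T_ℓ f (bT i₀)` at `i₀`
    set B := Algebra.TensorProduct.basis ℚ_[ℓ] bT with hB
    set a : ℤ_[ℓ] := bT.repr (tateModuleMap ℓ f (bT i₀)) i₀ with ha
    have hca : c = algebraMap ℤ_[ℓ] ℚ_[ℓ] a := by
      have h1 := key (bT i₀)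
      rw [TateModule.toRational_apply, TateModule.toRational_apply] at h1
      -- the same identity in `ℚ_ℓ ⊗ T_ℓ A` (the synonym `RationalTateModule` unfolded)
      have h1' : ((1 : ℚ_[ℓ]) ⊗ₜ[ℤ_[ℓ]] tateModuleMap ℓ f (bT i₀) : ℚ_[ℓ] ⊗[ℤ_[ℓ]] A.tateModule ℓ) =
          c • ((1 : ℚ_[ℓ]) ⊗ₜ[ℤ_[ℓ]] bT i₀ : ℚ_[ℓ] ⊗[ℤ_[ℓ]] A.tateModule ℓ) := h1
      have h2 := congrArg (fun v : ℚ_[ℓ] ⊗[ℤ_[ℓ]] A.tateModule ℓ => B.repr v i₀) h1'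
      rw [hB, Algebra.TensorProduct.basis_repr_tmul, map_smul, ← Algebra.TensorProduct.basis_apply,
        Module.Basis.repr_self] at h2
      simp only [Finsupp.smul_apply, Finsupp.mapRange_apply, one_smul, Finsupp.single_eq_same,
        smul_eq_mul, mul_one] at h2
      exact h2.symm
    refine ⟨a, fun x => TateModule.toRational_injective ?_⟩
    rw [key x, hca, algebraMap_smul, map_smul]

/-- **The lattice argument (Mumford §19, Theorem 3): if every `f ∈ End_K(A)` acts on `T_ℓ A ≠ 0` by a
scalar `a_f ∈ ℤ_ℓ` then `End_K(A) = ℤ · 𝟙`.** `End(A)` is a free `ℤ`-module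
(`module_free_hom_holds`) and the Tate map `ℤ_ℓ ⊗ End(A) → Hom_Γ(T_ℓ A, T_ℓ A)`, `c ⊗ f ↦ c · T_ℓ f`,
is injective (`faltingsTateMap_injective_holds`). For two elements `f₁ ≠ f₂` of a `ℤ`-basis,
`a_{f₂} ⊗ f₁ - a_{f₁} ⊗ f₂ ↦ (a_{f₂} a_{f₁} - a_{f₁} a_{f₂}) · id = 0`, so it vanishes, so `a_{f₂} = 0`,
so `1 ⊗ f₂ ↦ 0`, contradiction: the basis is a single `g`. Then `𝟙 = k g` and `g ∘ g = m g` give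
`1 = k a_g`, `a_g² = m a_g` (as `f ↦ a_f` is a ring map: `T_ℓ` is functorial and additive), hence
`k m = 1`, `k = ±1`, `g = ±𝟙` and every `f = n g ∈ ℤ · 𝟙`. [cite: MumfordAV1970, §19 Thm. 3 and Cor. 1] -/
theorem _root_.Literature.AlgebraicGeometry.Motives.AbelianVariety.forall_end_eq_zsmul_id_of_forall_tateModuleMap_eq_smul
    (A : AbelianVariety K) (ℓ : ℕ) [Fact ℓ.Prime] (hℓ : (ℓ : K) ≠ 0) [Nontrivial (A.tateModule ℓ)]
    (h : ∀ f : A ⟶ A, ∃ a : ℤ_[ℓ], ∀ x : A.tateModule ℓ, tateModuleMap ℓ f x = a • x) :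
    ∀ f : A ⟶ A, ∃ n : ℤ, f = n • 𝟙 A := by
  classical
  haveI : Module.Free ℤ_[ℓ] (A.tateModule ℓ) := module_free_tateModule_holds A ℓ hℓ
  haveI : Module.Free ℤ (A ⟶ A) := module_free_hom_holds A A
  have hinj : Function.Injective (faltingsTateMap A A ℓ) := faltingsTateMap_injective_holds A A ℓ hℓ
  choose a ha using h
  -- uniqueness of the scalar: `T_ℓ A` is a non-zero torsion-free `ℤ_ℓ`-module
  obtain ⟨t₀, ht₀⟩ := exists_ne (0 : A.tateModule ℓ)
  have huniq : ∀ {x y : ℤ_[ℓ]}, x • t₀ = y • t₀ → x = y := fun {x y} hxy => by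
    by_contra hne
    have h2 : (x - y) • t₀ = 0 := by rw [sub_smul, hxy, sub_self]
    exact ht₀ ((smul_eq_zero_iff_right (sub_ne_zero.2 hne)).1 h2)
  -- `a 𝟙 = 1`
  have a_id : a (𝟙 A) = 1 := by
    apply huniq
    rw [← ha (𝟙 A), tateModuleMap_id, one_smul, LinearMap.id_apply]
  -- multiplicativity `a (f ≫ g) = a f * a g`
  have a_comp : ∀ f g : A ⟶ A, a (f ≫ g) = a f * a g := fun f g => by
    apply huniq
    rw [← ha (f ≫ g), tateModuleMap_comp, LinearMap.comp_apply, ha f, map_smul, ha g, smul_smul,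
      mul_comm]
  -- additivity `a (f + g) = a f + a g`, hence `a (n • f) = n a f`
  have a_add : ∀ f g : A ⟶ A, a (f + g) = a f + a g := fun f g => by
    apply huniq
    rw [← ha (f + g), tateModuleMap_add, LinearMap.add_apply, ha f, ha g, add_smul]
  have a_zsmul : ∀ (n : ℤ) (f : A ⟶ A), a (n • f) = (n : ℤ_[ℓ]) * a f := fun n f => by
    have := map_zsmul (AddMonoidHom.mk' a a_add) n f
    simpa [zsmul_eq_mul] using this
  -- the underlying linear map of `faltingsTateMap (c ⊗ f)` at a point
  have hft : ∀ (c : ℤ_[ℓ]) (f : A ⟶ A) (x : A.tateModule ℓ),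
      (faltingsTateMap A A ℓ (c ⊗ₜ[ℤ] f)).toLinearMap x = (c * a f) • x := fun c f x => by
    rw [faltingsTateMap_tmul, Representation.IntertwiningMap.toLinearMap_smul, homToTate_apply,
      toLinearMap_tateIntertwiningMap, LinearMap.smul_apply, ha f, smul_smul]
  -- the Tate map kills `a g ⊗ f - a f ⊗ g`
  have hkill : ∀ f g : A ⟶ A,
      faltingsTateMap A A ℓ (a g ⊗ₜ[ℤ] f - a f ⊗ₜ[ℤ] g) = 0 := fun f g => by
    apply Representation.IntertwiningMap.ext
    refine LinearMap.ext fun x => ?_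
    rw [map_sub, Representation.IntertwiningMap.sub_toLinearMap, LinearMap.sub_apply, hft, hft,
      Representation.IntertwiningMap.zero_toLinearMap, LinearMap.zero_apply, mul_comm, sub_self]
  set β := Module.Free.chooseBasis ℤ (A ⟶ A) with hβ
  set Bt := Algebra.TensorProduct.basis ℤ_[ℓ] β with hBt
  -- every basis endomorphism has `a ≠ 0`
  have a_ne : ∀ i, a (β i) ≠ 0 := fun i h0 => by
    have h1 : faltingsTateMap A A ℓ ((1 : ℤ_[ℓ]) ⊗ₜ[ℤ] β i) = 0 := by
      apply Representation.IntertwiningMap.ext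
      refine LinearMap.ext fun x => ?_
      rw [hft, h0, Representation.IntertwiningMap.zero_toLinearMap, LinearMap.zero_apply, mul_zero,
        zero_smul]
    have h2 : ((1 : ℤ_[ℓ]) ⊗ₜ[ℤ] β i) = 0 := hinj (by rw [h1, map_zero])
    have h3 := congrArg (fun v => Bt.repr v i) h2
    simp only [hBt, Algebra.TensorProduct.basis_repr_tmul, map_zero, Finsupp.smul_apply,
      Finsupp.mapRange_apply, Module.Basis.repr_self, Finsupp.single_eq_same, map_one, smul_eq_mul,
      mul_one, Finsupp.coe_zero, Pi.zero_apply] at h3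
    exact one_ne_zero h3
  -- the basis index is a subsingleton
  have hsub : ∀ i j : Module.Free.ChooseBasisIndex ℤ (A ⟶ A), i = j := fun i j => by
    by_contra hij
    have h2 : (a (β j) ⊗ₜ[ℤ] β i - a (β i) ⊗ₜ[ℤ] β j : ℤ_[ℓ] ⊗[ℤ] (A ⟶ A)) = 0 :=
      hinj (by rw [hkill, map_zero])
    have h3 := congrArg (fun v => Bt.repr v i) h2
    simp only [hBt, map_sub, Algebra.TensorProduct.basis_repr_tmul, Finsupp.sub_apply,
      Finsupp.smul_apply, Finsupp.mapRange_apply, Module.Basis.repr_self, Finsupp.single_eq_same,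
      Finsupp.single_eq_of_ne hij, map_one, map_zero, smul_eq_mul, mul_one, mul_zero,
      sub_zero, Finsupp.coe_zero, Pi.zero_apply] at h3
    exact a_ne j h3
  -- `𝟙 A ≠ 0`, so the index is nonempty
  have hid : (𝟙 A : A ⟶ A) ≠ 0 := fun h0 => by
    have : a (𝟙 A) = 0 := by
      apply huniq
      rw [← ha (𝟙 A), h0, tateModuleMap_zero, zero_smul, LinearMap.zero_apply]
    rw [a_id] at this
    exact one_ne_zero this
  haveI : Nontrivial (A ⟶ A) := nontrivial_of_ne _ _ hid
  obtain ⟨i₀⟩ := β.index_nonempty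
  -- every endomorphism is an integer multiple of `g := β i₀`
  have hexp : ∀ f : A ⟶ A, f = (β.repr f i₀) • β i₀ := fun f => by
    have h1 : β.repr f = Finsupp.single i₀ (β.repr f i₀) := by
      ext i
      rw [hsub i i₀, Finsupp.single_eq_same]
    calc f = β.repr.symm (β.repr f) := (β.repr.symm_apply_apply f).symm
      _ = (β.repr f i₀) • β i₀ := by
          rw [h1, Module.Basis.repr_symm_single, Finsupp.single_eq_same]
  set g := β i₀ with hg
  obtain ⟨k₁, hk₁⟩ : ∃ k₁ : ℤ, 𝟙 A = k₁ • g := ⟨_, hexp (𝟙 A)⟩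
  obtain ⟨m, hm⟩ : ∃ m : ℤ, g ≫ g = m • g := ⟨_, hexp (g ≫ g)⟩
  have e1 : (1 : ℤ_[ℓ]) = (k₁ : ℤ_[ℓ]) * a g := by rw [← a_id, hk₁, a_zsmul]
  have e2 : a g * a g = (m : ℤ_[ℓ]) * a g := by rw [← a_comp, hm, a_zsmul]
  have ha0 : a g ≠ 0 := fun h0 => by
    rw [h0, mul_zero] at e1
    exact one_ne_zero e1
  have hag : a g = (m : ℤ_[ℓ]) := mul_right_cancel₀ ha0 e2
  have hk : k₁ * m = 1 := by
    have : ((k₁ * m : ℤ) : ℤ_[ℓ]) = 1 := by push_cast; rw [← hag, ← e1]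
    exact_mod_cast this
  have hkk : k₁ * k₁ = 1 := by
    rcases Int.eq_one_or_neg_one_of_mul_eq_one hk with rfl | rfl <;> norm_num
  have hg1 : g = k₁ • 𝟙 A := by
    rw [hk₁, smul_smul, hkk, one_smul]
  intro f
  refine ⟨β.repr f i₀ * k₁, ?_⟩
  conv_lhs => rw [hexp f]
  rw [hg1, smul_smul]

/-- **Irreducible `H¹ ⊗ ℚ̄_ℓ` ⟹ `End_K(A) = ℤ · 𝟙` (Faltings-free direction).** For an abelian variety
`A` over a field `K`, a prime `ℓ` invertible in `K`, a `ℚ_ℓ`-basis `b` of `V_ℓ A` indexed by `Fin d`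
and the framed continuous `r : Γ_K → GL_d(ℚ̄_ℓ)` with `r(g) = [g⁻¹]_bᵀ ⊗ ℚ̄_ℓ` — the representation on
`H¹_ét(A_K̄, ℚ̄_ℓ) = (V_ℓ A)^∨ ⊗ ℚ̄_ℓ` in the dual basis, the frame clause of
`bcgp_serreRegularWeight_implies_allAbelianSurfacesModular` —: if `r` is irreducible then every
endomorphism of `A` is an integer: `End_K(A) = ℤ · 𝟙`. Proof: `V_ℓ f` is scalar by Schur
(`exists_rationalTateModuleMap_eq_smul_id_of_isIrreducible_dualFrame`), hence `T_ℓ f` is a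
`ℤ_ℓ`-scalar (`exists_forall_tateModuleMap_eq_smul_of_rationalTateModuleMap_eq_smul_id`), and
Mumford's §19 Theorem 3 lattice argument concludes
(`forall_end_eq_zsmul_id_of_forall_tateModuleMap_eq_smul`); `T_ℓ A ≠ 0` because `V_ℓ A ≅ ℚ_ℓ^d` with
`d > 0` (an irreducible representation is non-zero). The converse ("`End_ℚ(A) = ℤ` ⟹ `H¹`
absolutely irreducible", Faltings 1983 Satz 3–4) is NOT used. Mumford, *Abelian Varieties*, §19,
Theorem 3 with Cor. 1; Schur. [cite: MumfordAV1970, §19 Thm. 3 and Cor. 1 (pp. 176–178)] -/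
theorem _root_.Literature.AlgebraicGeometry.Motives.AbelianVariety.forall_end_eq_zsmul_id_of_isIrreducible_dualFrame
    (A : AbelianVariety K) (ℓ : ℕ) [Fact ℓ.Prime] (hℓ : (ℓ : K) ≠ 0) {d : ℕ}
    (b : Module.Basis (Fin d) ℚ_[ℓ] (A.rationalTateModule ℓ))
    (r : FramedGaloisRep K (PadicAlgCl ℓ) d)
    (hr : ∀ g : Field.absoluteGaloisGroup K,
      (r g).val = ((LinearMap.toMatrix b b (A.rationalTateRep ℓ g⁻¹)).map
        (algebraMap ℚ_[ℓ] (PadicAlgCl ℓ))).transpose)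
    (hirr : r.toGaloisRep.IsIrreducible) :
    ∀ f : A ⟶ A, ∃ n : ℤ, f = n • 𝟙 A := by
  -- `d > 0`: an irreducible representation lives on a non-zero space
  have hd : 0 < d := by
    rcases Nat.eq_zero_or_pos d with hd0 | hd0
    · exfalso
      subst hd0
      haveI := hirr
      have hnt : Nontrivial (Subrepresentation r.toGaloisRep.toRepresentation) := inferInstance
      obtain ⟨S₁, S₂, hne⟩ := hnt.exists_pair_ne
      exact hne (Subrepresentation.toSubmodule_injective (Subsingleton.elim _ _))
    · exact hd0
  -- hence `V_ℓ A ≠ 0` and `T_ℓ A ≠ 0`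
  haveI : Nontrivial (A.tateModule ℓ) := by
    by_contra hT
    haveI : Subsingleton (A.tateModule ℓ) := not_nontrivial_iff_subsingleton.1 hT
    have hzero : ∀ v : ℚ_[ℓ] ⊗[ℤ_[ℓ]] A.tateModule ℓ, v = 0 := fun v => by
      induction v using TensorProduct.induction_on with
      | zero => rfl
      | tmul x y => rw [Subsingleton.elim y 0, TensorProduct.tmul_zero]
      | add x y hx hy => rw [hx, hy, add_zero]
    exact b.ne_zero ⟨0, hd⟩ (hzero (b ⟨0, hd⟩))
  refine A.forall_end_eq_zsmul_id_of_forall_tateModuleMap_eq_smul ℓ hℓ fun f => ?_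
  obtain ⟨c, hc⟩ := A.exists_rationalTateModuleMap_eq_smul_id_of_isIrreducible_dualFrame ℓ b r hr hirr f
  exact A.exists_forall_tateModuleMap_eq_smul_of_rationalTateModuleMap_eq_smul_id ℓ hℓ f hc

end Schur

/-! ## Part 2. The fact from the wreath fact and its quadratically primitive slice -/

/-- **DEPRECATED bookkeeping (2026-08-17): its conclusion is the deprecated (misstated) `∃ μ`
record `bcgp_serreRegularWeight_implies_allAbelianSurfacesModular`; the same decomposition for the
CORRECTED statement is `bcgp_serreRegularWeightFixedSimilitude_of_wreathFixedSimilitude_of_primitive`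
(Part 4). Statement and proof unchanged.**
`bcgp_serreRegularWeight_implies_allAbelianSurfacesModular` = (wreath fact) ⊕ (primitive
slice). GRANTED the sibling named fact `bcgp_serreWreath_implies_quadraticImprimitiveSurfacesModular`
(BCGP 2025 Lemma 10.4.1 along its proof for Galois type **B**[C₂], p. 146, + Theorem 10.2.1; unproved
in the tree) and the quadratically PRIMITIVE slice of the fact — its hypothesis bracket VERBATIM ⟹
modularity of the abelian surfaces `A/ℚ` whose framed dual `H¹ ⊗ ℚ̄_ℓ` is irreducible and stays
irreducible over every quadratic field (in print: proof of Lemma 10.4.1 for type **A**, p. 146, +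
Theorem 10.2.1 for the remaining primitive types; stated inline as the hypothesis `hP`, no definition)
—, the fact follows: given its hypothesis `hH` and a surface with irreducible `r`, either `r|Γ_K` is
reducible for some quadratic `K` — then `End_ℚ(A) = ℤ · 𝟙` by the Faltings-free
`AbelianVariety.forall_end_eq_zsmul_id_of_isIrreducible_dualFrame` (Mumford §19 Thm. 3 + Schur),
`hH` restricts to the wreath residues by dropping antecedents (pure logic, the route-side stub
`stub_serreWreath_of_ordinarySerre` re-derived inline), and the wreath fact yields the cuspidal `π` —
or it is not, and `hP` yields it. So the tree-debt of the fact beyond the wreath fact is the primitive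
slice alone (and the review's over-claim on imprimitive residues, module docstring, sits entirely in
the wreath fact's sector). [cite: BoxerCalegariGeePilloni2025, Lemma 10.4.1, Rem. 10.4.2, proof p. 146; Thm 10.2.1; Def. 1.8.12]
[cite: MumfordAV1970, §19 Thm. 3 and Cor. 1] -/
@[deprecated "its conclusion is the deprecated (misstated) record \
bcgp_serreRegularWeight_implies_allAbelianSurfacesModular; use \
Literature.NumberTheory.DiophantineGeometry.bcgp_serreRegularWeightFixedSimilitude_of_wreathFixedSimilitude_of_primitive \
(Part 4 of this file: the same decomposition for the corrected, fixed-similitude statement)"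
  (since := "2026-08-17")]
theorem bcgp_serreRegularWeight_implies_allAbelianSurfacesModular_of_wreath_of_primitive
    (hW : bcgp_serreWreath_implies_quadraticImprimitiveSurfacesModular)
    (hP : (∃ P₀ : ℕ, ∀ (p : ℕ) [Fact p.Prime], P₀ ≤ p → ∀ (k : Type) [Field k] [CharP k p] [IsAlgClosed k]
        [TopologicalSpace k] [DiscreteTopology k] (red : Valued.integer (PadicAlgCl p) →+* k) (ρb :
        FramedGaloisRep ℚ k 4), ρb.toGaloisRep.IsIrreducible →
        ρb.IsSymplecticWithMultiplierFun (fun g => (((Units.map (ZMod.castHom (dvd_refl p)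
        k).toMonoidHom ((modularCyclotomicCharacter (AlgebraicClosure ℚ)
        (HasEnoughRootsOfUnity.natCard_rootsOfUnity (AlgebraicClosure ℚ) p)).comp
        (MulSemiringAction.toRingAut (Field.absoluteGaloisGroup ℚ) (AlgebraicClosure ℚ)) g))⁻¹ : kˣ)
        : k)) → (∀ v : HeightOneSpectrum (𝓞 ℚ), ((p : ℕ) : 𝓞 ℚ) ∈ v.asIdeal → ∃ g : GL (Fin 4) k,
        ∀ (τ : Field.absoluteGaloisGroup (v.adicCompletion ℚ)) (i j : Fin 4), j < i →
        (g * ρb.toLocal v τ * g⁻¹).val i j = 0) → ∀ (hcpt : isCompact_glFiniteIntegralLevel 4 ℚ) (ι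
        : PadicAlgCl p ≃+* ℂ), ∃ (π : CuspidalAutomorphicRepData 4 ℚ hcpt) (r : FramedGaloisRep ℚ
        (PadicAlgCl p) 4), π.1.IsRegularAlgebraic ∧
        (∀ v : HeightOneSpectrum (𝓞 ℚ), ((p : ℕ) : 𝓞 ℚ) ∈ v.asIdeal → π.1.IsUnramifiedAt v) ∧
        (∃ μ : Field.absoluteGaloisGroup ℚ → PadicAlgCl p, r.IsSymplecticWithMultiplierFun μ) ∧
        (∀ v : HeightOneSpectrum (𝓞 ℚ), ((p : ℕ) : 𝓞 ℚ) ∈ v.asIdeal → ∃ a : Fin 4 →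
        ℕ, Function.Injective a ∧ r.IsGreenbergOrdinaryOfShapeAt v a) ∧
        (∀ᶠ v : HeightOneSpectrum (𝓞 ℚ) in Filter.cofinite,
        ∃ α : Multiset ℂ, π.1.HasSatakeParamAt v α ∧ r.IsUnramifiedAt v ∧
        r.HasFrobCharpolyAt v (arithFrobPolyOfSatake ι v.residueCard 4 α)) ∧
        (∀ᶠ v : HeightOneSpectrum (𝓞 ℚ) in Filter.cofinite, r.IsUnramifiedAt v ∧
        ρb.IsUnramifiedAt v ∧ ∃ (P : Polynomial (Valued.integer (PadicAlgCl p))) (Pb : Polynomial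
        k), r.HasFrobCharpolyAt v (P.map (Valued.integer (PadicAlgCl p)).subtype) ∧
        ρb.HasFrobCharpolyAt v Pb ∧ P.map red = Pb)) →
      ∀ (A : AbelianVariety ℚ), A.dim = 2 → ∀ (ℓ : ℕ) [Fact ℓ.Prime] (b : Module.Basis (Fin 4) ℚ_[ℓ]
        (A.rationalTateModule ℓ)) (r : FramedGaloisRep ℚ (PadicAlgCl ℓ) 4),
        (∀ g : Field.absoluteGaloisGroup ℚ, (r g).val = ((LinearMap.toMatrix b b (A.rationalTateRep ℓ
        g⁻¹)).map (algebraMap ℚ_[ℓ] (PadicAlgCl ℓ))).transpose) → r.toGaloisRep.IsIrreducible →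
        (∀ (K : Type) [Field K] [NumberField K], Module.finrank ℚ K = 2 →
          FramedRep.IsIrreducible (r.restrictField K)) →
        ∀ (hcpt : isCompact_glFiniteIntegralLevel 4 ℚ) (ι : PadicAlgCl ℓ ≃+* ℂ),
        ∃ π : CuspidalAutomorphicRepData 4 ℚ hcpt, π.1.IsLAlgebraic ∧
        ∀ᶠ v : HeightOneSpectrum (𝓞 ℚ) in Filter.cofinite,
        ∃ a : Multiset ℂ, π.1.HasSatakeParamAt v a ∧ r.IsUnramifiedAt v ∧
        r.HasFrobCharpolyAt v (arithFrobPolyOfSatake ι v.residueCard 1 a)) :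
    bcgp_serreRegularWeight_implies_allAbelianSurfacesModular := by
  intro hH A hA ℓ _ b r hr hirr hcpt ι
  by_cases himp : ∃ (K : Type) (_ : Field K) (_ : NumberField K), Module.finrank ℚ K = 2 ∧
      ¬ FramedRep.IsIrreducible (r.restrictField K)
  · -- imprimitive: `End_ℚ(A) = ℤ` by Part 1, then the wreath fact
    have hEnd : ∀ f : A ⟶ A, ∃ n : ℤ, f = n • 𝟙 A :=
      A.forall_end_eq_zsmul_id_of_isIrreducible_dualFrame ℓ
        (Nat.cast_ne_zero.2 (Fact.out : ℓ.Prime).ne_zero) b r hr hirr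
    refine hW ?_ A hA hEnd ℓ b r hr himp hcpt ι
    -- the hypothesis restricted to the wreath residues (drop antecedents)
    obtain ⟨P₀, h⟩ := hH
    refine ⟨P₀, ?_⟩
    intro p _ hp k _ _ _ _ _ red ρb hirr' hsymp htri _hcard _hcyc _hK hcpt' ι'
    exact h p hp k red ρb hirr' hsymp (fun v hv => (htri v hv).imp fun g hg => hg.1) hcpt' ι'
  · -- primitive: the primitive slice
    have hprim : ∀ (K : Type) [Field K] [NumberField K], Module.finrank ℚ K = 2 →
        FramedRep.IsIrreducible (r.restrictField K) := fun K hF hNF hK => by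
      by_contra hc
      exact himp ⟨K, hF, hNF, hK, hc⟩
    exact hP hH A hA ℓ b r hr hirr hprim hcpt ι

/-! ## Part 3 (appended). The pinned-multiplier hypothesis bracket, type-checked

The `## Review` in the module docstring of the fact (and `## Status` above) find that the hypothesis
output clause `∃ μ, r.IsSymplecticWithMultiplierFun μ` is weaker than the source's "central character
`|·|²`" (`ν ∘ ρ_{π,p} = ε⁻¹`, BCGP §1.8.9, p. 9), so that on imprimitive residues the fact over-claims.
The faithful clause proposed by this seat pins the multiplier to the pure cyclotomic power
`ε_p^{-(1 + 2(p-1)m)}` (`ε_p = GaloisRep.cyclotomicCharacter ℚ p` pushed into `ℚ̄_p`): it is met by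
the printed `π` (weight `(k, l; 2)`) through `r := ρ_{π,p} ⊗ ε^{-(p-1)m}`, `(p-1)m ≥ (k+l)/2 - 2`, and
conversely an `|ν|^{(p-1)m}`-twist of the descended `π'` restores central character `|·|²` exactly
without moving `ρ̄` (`ε̄^{(p-1)m} = 1`) or the level at `p`. The bracket itself is a ROUTE definition
(`RegularSerreAbelianSurfaces.OrdinarySerreGSp4`, applied verbatim by two `Summits` modules), so the
restatement is the planner's; here the pinned bracket is only WRITTEN OUT AND ELABORATED (no
definition, no named fact), with the two pure-logic comparisons a planner needs: the pinned
hypothesis implies the present one (`ordinarySerre_of_ordinarySerrePinned`), hence the present fact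
implies its pinned variant (`bcgp_serreRegularWeightPinned_implies_allAbelianSurfacesModular_of`) —
the variant that Lemma 10.4.1 ∘ (descent `GL₄ → GSp₄`) does prove on every sector. -/

/-- **Pinned ⟹ free multiplier (pure logic).** Serre's conjecture for `GSp₄/ℚ` in regular ordinary
weight through the `GL₄` proxy with the similitude character of the witness PINNED to
`ε_p^{-(1 + 2(p-1)m)}` for some `m : ℕ` (the faithful rendering of "central character `|·|²`",
BCGP §1.8.9 p. 9 and Lemma 10.4.1) implies the hypothesis bracket of
`bcgp_serreRegularWeight_implies_allAbelianSurfacesModular` as it stands (`∃ μ`): take `μ` to be that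
power. [cite: BoxerCalegariGeePilloni2025, §1.8.9 (p. 9, central character |·|², ν ∘ ρ_{π,p} = ε⁻¹) and Lemma 10.4.1] -/
theorem ordinarySerre_of_ordinarySerrePinned
    (h : ∃ P₀ : ℕ, ∀ (p : ℕ) [Fact p.Prime], P₀ ≤ p → ∀ (k : Type) [Field k] [CharP k p] [IsAlgClosed k]
        [TopologicalSpace k] [DiscreteTopology k] (red : Valued.integer (PadicAlgCl p) →+* k) (ρb :
        FramedGaloisRep ℚ k 4), ρb.toGaloisRep.IsIrreducible →
        ρb.IsSymplecticWithMultiplierFun (fun g => (((Units.map (ZMod.castHom (dvd_refl p)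
        k).toMonoidHom ((modularCyclotomicCharacter (AlgebraicClosure ℚ)
        (HasEnoughRootsOfUnity.natCard_rootsOfUnity (AlgebraicClosure ℚ) p)).comp
        (MulSemiringAction.toRingAut (Field.absoluteGaloisGroup ℚ) (AlgebraicClosure ℚ)) g))⁻¹ : kˣ)
        : k)) → (∀ v : HeightOneSpectrum (𝓞 ℚ), ((p : ℕ) : 𝓞 ℚ) ∈ v.asIdeal → ∃ g : GL (Fin 4) k,
        ∀ (τ : Field.absoluteGaloisGroup (v.adicCompletion ℚ)) (i j : Fin 4), j < i →
        (g * ρb.toLocal v τ * g⁻¹).val i j = 0) → ∀ (hcpt : isCompact_glFiniteIntegralLevel 4 ℚ) (ι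
        : PadicAlgCl p ≃+* ℂ), ∃ (π : CuspidalAutomorphicRepData 4 ℚ hcpt) (r : FramedGaloisRep ℚ
        (PadicAlgCl p) 4), π.1.IsRegularAlgebraic ∧
        (∀ v : HeightOneSpectrum (𝓞 ℚ), ((p : ℕ) : 𝓞 ℚ) ∈ v.asIdeal → π.1.IsUnramifiedAt v) ∧
        (∃ m : ℕ, r.IsSymplecticWithMultiplierFun (fun g => (algebraMap ℚ_[p] (PadicAlgCl p)
          ((((GaloisRep.cyclotomicCharacter ℚ p g)⁻¹ : ℤ_[p]ˣ) : ℤ_[p]) : ℚ_[p])) ^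
          (1 + 2 * (p - 1) * m))) ∧
        (∀ v : HeightOneSpectrum (𝓞 ℚ), ((p : ℕ) : 𝓞 ℚ) ∈ v.asIdeal → ∃ a : Fin 4 →
        ℕ, Function.Injective a ∧ r.IsGreenbergOrdinaryOfShapeAt v a) ∧
        (∀ᶠ v : HeightOneSpectrum (𝓞 ℚ) in Filter.cofinite,
        ∃ α : Multiset ℂ, π.1.HasSatakeParamAt v α ∧ r.IsUnramifiedAt v ∧
        r.HasFrobCharpolyAt v (arithFrobPolyOfSatake ι v.residueCard 4 α)) ∧
        (∀ᶠ v : HeightOneSpectrum (𝓞 ℚ) in Filter.cofinite, r.IsUnramifiedAt v ∧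
        ρb.IsUnramifiedAt v ∧ ∃ (P : Polynomial (Valued.integer (PadicAlgCl p))) (Pb : Polynomial
        k), r.HasFrobCharpolyAt v (P.map (Valued.integer (PadicAlgCl p)).subtype) ∧
        ρb.HasFrobCharpolyAt v Pb ∧ P.map red = Pb)) :
    ∃ P₀ : ℕ, ∀ (p : ℕ) [Fact p.Prime], P₀ ≤ p → ∀ (k : Type) [Field k] [CharP k p] [IsAlgClosed k]
        [TopologicalSpace k] [DiscreteTopology k] (red : Valued.integer (PadicAlgCl p) →+* k) (ρb :
        FramedGaloisRep ℚ k 4), ρb.toGaloisRep.IsIrreducible →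
        ρb.IsSymplecticWithMultiplierFun (fun g => (((Units.map (ZMod.castHom (dvd_refl p)
        k).toMonoidHom ((modularCyclotomicCharacter (AlgebraicClosure ℚ)
        (HasEnoughRootsOfUnity.natCard_rootsOfUnity (AlgebraicClosure ℚ) p)).comp
        (MulSemiringAction.toRingAut (Field.absoluteGaloisGroup ℚ) (AlgebraicClosure ℚ)) g))⁻¹ : kˣ)
        : k)) → (∀ v : HeightOneSpectrum (𝓞 ℚ), ((p : ℕ) : 𝓞 ℚ) ∈ v.asIdeal → ∃ g : GL (Fin 4) k,
        ∀ (τ : Field.absoluteGaloisGroup (v.adicCompletion ℚ)) (i j : Fin 4), j < i →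
        (g * ρb.toLocal v τ * g⁻¹).val i j = 0) → ∀ (hcpt : isCompact_glFiniteIntegralLevel 4 ℚ) (ι
        : PadicAlgCl p ≃+* ℂ), ∃ (π : CuspidalAutomorphicRepData 4 ℚ hcpt) (r : FramedGaloisRep ℚ
        (PadicAlgCl p) 4), π.1.IsRegularAlgebraic ∧
        (∀ v : HeightOneSpectrum (𝓞 ℚ), ((p : ℕ) : 𝓞 ℚ) ∈ v.asIdeal → π.1.IsUnramifiedAt v) ∧
        (∃ μ : Field.absoluteGaloisGroup ℚ → PadicAlgCl p, r.IsSymplecticWithMultiplierFun μ) ∧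
        (∀ v : HeightOneSpectrum (𝓞 ℚ), ((p : ℕ) : 𝓞 ℚ) ∈ v.asIdeal → ∃ a : Fin 4 →
        ℕ, Function.Injective a ∧ r.IsGreenbergOrdinaryOfShapeAt v a) ∧
        (∀ᶠ v : HeightOneSpectrum (𝓞 ℚ) in Filter.cofinite,
        ∃ α : Multiset ℂ, π.1.HasSatakeParamAt v α ∧ r.IsUnramifiedAt v ∧
        r.HasFrobCharpolyAt v (arithFrobPolyOfSatake ι v.residueCard 4 α)) ∧
        (∀ᶠ v : HeightOneSpectrum (𝓞 ℚ) in Filter.cofinite, r.IsUnramifiedAt v ∧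
        ρb.IsUnramifiedAt v ∧ ∃ (P : Polynomial (Valued.integer (PadicAlgCl p))) (Pb : Polynomial
        k), r.HasFrobCharpolyAt v (P.map (Valued.integer (PadicAlgCl p)).subtype) ∧
        ρb.HasFrobCharpolyAt v Pb ∧ P.map red = Pb) := by
  obtain ⟨P₀, h⟩ := h
  refine ⟨P₀, ?_⟩
  intro p _ hp k _ _ _ _ _ red ρb hirr hsymp htri hcpt ι
  obtain ⟨π, r, h1, h2, ⟨m, hm⟩, h4, h5, h6⟩ := h p hp k red ρb hirr hsymp htri hcpt ι
  exact ⟨π, r, h1, h2, ⟨_, hm⟩, h4, h5, h6⟩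

/-- **DEPRECATED bookkeeping (2026-08-17): its hypothesis `hF` is the deprecated (misstated) `∃ μ`
record `bcgp_serreRegularWeight_implies_allAbelianSurfacesModular`; the pinned form is related to the
CORRECTED statement directly by `serreToAbelianSurfacesFixedSimilitude_iff_pinned` (Part 4), and the
record implies the corrected statement by
`bcgp_serreRegularWeightFixedSimilitude_implies_allAbelianSurfacesModular_of_serreRegularWeight`
(fact file). Statement and proof unchanged.**
The fact implies its pinned-multiplier variant (pure logic). From
`bcgp_serreRegularWeight_implies_allAbelianSurfacesModular` (hypothesis with a free multiplier) follows
the same implication with the PINNED hypothesis bracket of `ordinarySerre_of_ordinarySerrePinned` —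
the variant faithful to the source on every sector (BCGP §1.8.9 p. 9, Lemma 10.4.1, Rem. 10.4.2,
Thm. 10.2.1): a stronger hypothesis gives a weaker implication. Recorded so that a route restated with
the pinned bracket keeps every consumer of the present fact.
[cite: BoxerCalegariGeePilloni2025, Lemma 10.4.1, Rem. 10.4.2, Thm 10.2.1, §1.8.9] -/
@[deprecated "its hypothesis is the deprecated (misstated) record \
bcgp_serreRegularWeight_implies_allAbelianSurfacesModular; relate the pinned form to the corrected \
statement with Literature.NumberTheory.DiophantineGeometry.serreToAbelianSurfacesFixedSimilitude_iff_pinned \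
(Part 4 of this file)" (since := "2026-08-17")]
theorem bcgp_serreRegularWeightPinned_implies_allAbelianSurfacesModular_of
    (hF : bcgp_serreRegularWeight_implies_allAbelianSurfacesModular)
    (h : ∃ P₀ : ℕ, ∀ (p : ℕ) [Fact p.Prime], P₀ ≤ p → ∀ (k : Type) [Field k] [CharP k p] [IsAlgClosed k]
        [TopologicalSpace k] [DiscreteTopology k] (red : Valued.integer (PadicAlgCl p) →+* k) (ρb :
        FramedGaloisRep ℚ k 4), ρb.toGaloisRep.IsIrreducible →
        ρb.IsSymplecticWithMultiplierFun (fun g => (((Units.map (ZMod.castHom (dvd_refl p)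
        k).toMonoidHom ((modularCyclotomicCharacter (AlgebraicClosure ℚ)
        (HasEnoughRootsOfUnity.natCard_rootsOfUnity (AlgebraicClosure ℚ) p)).comp
        (MulSemiringAction.toRingAut (Field.absoluteGaloisGroup ℚ) (AlgebraicClosure ℚ)) g))⁻¹ : kˣ)
        : k)) → (∀ v : HeightOneSpectrum (𝓞 ℚ), ((p : ℕ) : 𝓞 ℚ) ∈ v.asIdeal → ∃ g : GL (Fin 4) k,
        ∀ (τ : Field.absoluteGaloisGroup (v.adicCompletion ℚ)) (i j : Fin 4), j < i →
        (g * ρb.toLocal v τ * g⁻¹).val i j = 0) → ∀ (hcpt : isCompact_glFiniteIntegralLevel 4 ℚ) (ι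
        : PadicAlgCl p ≃+* ℂ), ∃ (π : CuspidalAutomorphicRepData 4 ℚ hcpt) (r : FramedGaloisRep ℚ
        (PadicAlgCl p) 4), π.1.IsRegularAlgebraic ∧
        (∀ v : HeightOneSpectrum (𝓞 ℚ), ((p : ℕ) : 𝓞 ℚ) ∈ v.asIdeal → π.1.IsUnramifiedAt v) ∧
        (∃ m : ℕ, r.IsSymplecticWithMultiplierFun (fun g => (algebraMap ℚ_[p] (PadicAlgCl p)
          ((((GaloisRep.cyclotomicCharacter ℚ p g)⁻¹ : ℤ_[p]ˣ) : ℤ_[p]) : ℚ_[p])) ^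
          (1 + 2 * (p - 1) * m))) ∧
        (∀ v : HeightOneSpectrum (𝓞 ℚ), ((p : ℕ) : 𝓞 ℚ) ∈ v.asIdeal → ∃ a : Fin 4 →
        ℕ, Function.Injective a ∧ r.IsGreenbergOrdinaryOfShapeAt v a) ∧
        (∀ᶠ v : HeightOneSpectrum (𝓞 ℚ) in Filter.cofinite,
        ∃ α : Multiset ℂ, π.1.HasSatakeParamAt v α ∧ r.IsUnramifiedAt v ∧
        r.HasFrobCharpolyAt v (arithFrobPolyOfSatake ι v.residueCard 4 α)) ∧
        (∀ᶠ v : HeightOneSpectrum (𝓞 ℚ) in Filter.cofinite, r.IsUnramifiedAt v ∧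
        ρb.IsUnramifiedAt v ∧ ∃ (P : Polynomial (Valued.integer (PadicAlgCl p))) (Pb : Polynomial
        k), r.HasFrobCharpolyAt v (P.map (Valued.integer (PadicAlgCl p)).subtype) ∧
        ρb.HasFrobCharpolyAt v Pb ∧ P.map red = Pb)) :
    ∀ (A : AbelianVariety ℚ), A.dim = 2 → ∀ (ℓ : ℕ) [Fact ℓ.Prime] (b : Module.Basis (Fin 4) ℚ_[ℓ]
      (A.rationalTateModule ℓ)) (r : FramedGaloisRep ℚ (PadicAlgCl ℓ) 4),
      (∀ g : Field.absoluteGaloisGroup ℚ, (r g).val = ((LinearMap.toMatrix b b (A.rationalTateRep ℓ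
      g⁻¹)).map (algebraMap ℚ_[ℓ] (PadicAlgCl ℓ))).transpose) → r.toGaloisRep.IsIrreducible →
      ∀ (hcpt : isCompact_glFiniteIntegralLevel 4 ℚ) (ι : PadicAlgCl ℓ ≃+* ℂ),
      ∃ π : CuspidalAutomorphicRepData 4 ℚ hcpt, π.1.IsLAlgebraic ∧
      ∀ᶠ v : HeightOneSpectrum (𝓞 ℚ) in Filter.cofinite,
      ∃ a : Multiset ℂ, π.1.HasSatakeParamAt v a ∧ r.IsUnramifiedAt v ∧
      r.HasFrobCharpolyAt v (arithFrobPolyOfSatake ι v.residueCard 1 a) :=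
  hF (ordinarySerre_of_ordinarySerrePinned h)


/-! ## Part 4 (appended). The corrected, fixed-similitude statements: the two typed forms agree, and
the decomposition "wreath fact ⊕ primitive slice" carries over

Since Part 3 was written the correction has taken its final typed form in the tree: `## Review 2` of
the fact's module docstring (misstated on BOTH sectors — the second similitude class `ε̄⁻¹η̄_K` at
an imprimitive residue, and, at every residue, witnesses of odd Tate parity, `p - 1 ∤ s`, which
certify the printed hypothesis at `ρ̄ ⊗ η̄_p` instead of `ρ̄`) states the corrected implication as the
conclusion type of `bcgp_serreRegularWeightFixedSimilitude_implies_allAbelianSurfacesModular_of_serreRegularWeight`,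
with the clause `∃ s : ℕ, p - 1 ∣ s ∧ r.IsSymplecticWithMultiplierFun (g ↦ ε_p(g)^{-(1+2s)})` —
VERBATIM the clause of the corrected wreath fact, now NAMED
`bcgp_serreWreathFixedSimilitude_implies_quadraticImprimitiveSurfacesModular`
(`BcgpSerreWreathFixedSimilitudeImprimitiveSurfaces.lean`). Part 3's pinned clause `∃ m : ℕ,
multiplier (ε_p(g)⁻¹)^{1+2(p-1)m}` is the same condition written with `s = (p-1)m` (it already had
the parity built in). This part records, theorems only:

* `exists_dvd_isSymplectic_cyclotomicPow_iff`, `ordinarySerreFixedSimilitude_iff_ordinarySerrePinned`,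
  `serreToAbelianSurfacesFixedSimilitude_iff_pinned` — the two typed forms of the corrected
  hypothesis bracket, and of the corrected implication, are EQUIVALENT (pure algebra: `map_pow` and
  `s = (p-1)m`), so whichever form the planner of `Langlands/RegularSerreAbelianSurfaces` gives
  `OrdinarySerreGSp4`, Part 3 and `## Review 2` speak about the same statement;
* `serreWreathFixedSimilitude_of_ordinarySerreFixedSimilitude` — the corrected hypothesis restricts
  to the wreath residues (drop antecedents; the fixed-similitude twin of the route stub
  `stub_serreWreath_of_ordinarySerre`);
* `bcgp_serreRegularWeightFixedSimilitude_of_wreathFixedSimilitude_of_primitive` — **the corrected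
  implication = (corrected wreath fact) ⊕ (its quadratically primitive slice)**: Part 2 verbatim on the
  corrected statements, through the Faltings-free `End_ℚ(A) = ℤ` theorem of Part 1. So after the
  correction, exactly as before it, the tree-debt of "Serre in regular weight ⟹ all abelian surfaces
  modular" beyond the named wreath fact is the primitive (type **A** / potentially abelian) slice,
  stated inline as the hypothesis `hP` (in print: proof of Lemma 10.4.1 for type **A**, p. 146, +
  Theorem 10.2.1), and nothing is claimed beyond the source on either sector. -/

/-- **The two typed forms of "multiplier exactly an odd power of `ε_p⁻¹` of even Tate parity" agree.**
For a framed `r : Γ_ℚ → GL₄(ℚ̄_p)`: (`∃ s`, `p - 1 ∣ s`, multiplier `g ↦ ι_p(ε_p(g)^{-(1+2s)})`) ↔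
(`∃ m`, multiplier `g ↦ ι_p(ε_p(g)⁻¹)^{1+2(p-1)m}`), `ι_p = algebraMap ℚ_[p] ℚ̄_p`: the first is the
clause of `## Review 2` and of `bcgp_serreWreathFixedSimilitude_implies_quadraticImprimitiveSurfacesModular`,
the second that of Part 3 (`map_pow`, `s = (p-1)m`). [cite: BoxerCalegariGeePilloni2025, §1.8.9 (ν ∘ ρ_{π,p} = ε⁻¹), Lemma 10.4.1] -/
theorem exists_dvd_isSymplectic_cyclotomicPow_iff {p : ℕ} [Fact p.Prime]
    (r : FramedGaloisRep ℚ (PadicAlgCl p) 4) :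
    (∃ s : ℕ, (p - 1) ∣ s ∧ r.IsSymplecticWithMultiplierFun (fun g => algebraMap ℚ_[p]
      (PadicAlgCl p) (((((GaloisRep.cyclotomicCharacter ℚ p g)⁻¹ : ℤ_[p]ˣ) : ℤ_[p]) : ℚ_[p]) ^
      (1 + 2 * s)))) ↔
    (∃ m : ℕ, r.IsSymplecticWithMultiplierFun (fun g => (algebraMap ℚ_[p] (PadicAlgCl p)
      ((((GaloisRep.cyclotomicCharacter ℚ p g)⁻¹ : ℤ_[p]ˣ) : ℤ_[p]) : ℚ_[p])) ^
      (1 + 2 * (p - 1) * m))) := by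
  constructor
  · rintro ⟨s, ⟨m, rfl⟩, hs⟩
    refine ⟨m, ?_⟩
    have hfun : (fun g => (algebraMap ℚ_[p] (PadicAlgCl p)
        ((((GaloisRep.cyclotomicCharacter ℚ p g)⁻¹ : ℤ_[p]ˣ) : ℤ_[p]) : ℚ_[p])) ^
        (1 + 2 * (p - 1) * m)) = (fun g => algebraMap ℚ_[p] (PadicAlgCl p)
        (((((GaloisRep.cyclotomicCharacter ℚ p g)⁻¹ : ℤ_[p]ˣ) : ℤ_[p]) : ℚ_[p]) ^
        (1 + 2 * ((p - 1) * m)))) := by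
      funext g
      rw [map_pow, mul_assoc]
    rw [hfun]
    exact hs
  · rintro ⟨m, hm⟩
    refine ⟨(p - 1) * m, dvd_mul_right _ _, ?_⟩
    have hfun : (fun g => algebraMap ℚ_[p] (PadicAlgCl p)
        (((((GaloisRep.cyclotomicCharacter ℚ p g)⁻¹ : ℤ_[p]ˣ) : ℤ_[p]) : ℚ_[p]) ^
        (1 + 2 * ((p - 1) * m)))) = (fun g => (algebraMap ℚ_[p] (PadicAlgCl p)
        ((((GaloisRep.cyclotomicCharacter ℚ p g)⁻¹ : ℤ_[p]ˣ) : ℤ_[p]) : ℚ_[p])) ^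
        (1 + 2 * (p - 1) * m)) := by
      funext g
      rw [map_pow, mul_assoc]
    rw [hfun]
    exact hm

/-- **The corrected hypothesis bracket: the `## Review 2` form ↔ the Part-3 (pinned) form.** Serre's
conjecture for `GSp₄/ℚ` in regular ordinary weight through the `GL₄` proxy with the similitude of
the lift FIXED — written with `∃ s, p - 1 ∣ s, ε_p^{-(1+2s)}` (the form of `## Review 2` and of the
named corrected wreath fact) or with `∃ m, (ε_p⁻¹)^{1+2(p-1)m}` (Part 3) — is one and the same
statement. Pure logic over `exists_dvd_isSymplectic_cyclotomicPow_iff`.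
[cite: BoxerCalegariGeePilloni2025, Lemma 10.4.1, Rem. 10.4.2, §1.8.9] -/
theorem ordinarySerreFixedSimilitude_iff_ordinarySerrePinned :
    (∃ P₀ : ℕ, ∀ (p : ℕ) [Fact p.Prime], P₀ ≤ p → ∀ (k : Type) [Field k] [CharP k p] [IsAlgClosed k]
        [TopologicalSpace k] [DiscreteTopology k] (red : Valued.integer (PadicAlgCl p) →+* k) (ρb :
        FramedGaloisRep ℚ k 4), ρb.toGaloisRep.IsIrreducible →
        ρb.IsSymplecticWithMultiplierFun (fun g => (((Units.map (ZMod.castHom (dvd_refl p)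
        k).toMonoidHom ((modularCyclotomicCharacter (AlgebraicClosure ℚ)
        (HasEnoughRootsOfUnity.natCard_rootsOfUnity (AlgebraicClosure ℚ) p)).comp
        (MulSemiringAction.toRingAut (Field.absoluteGaloisGroup ℚ) (AlgebraicClosure ℚ)) g))⁻¹ : kˣ)
        : k)) → (∀ v : HeightOneSpectrum (𝓞 ℚ), ((p : ℕ) : 𝓞 ℚ) ∈ v.asIdeal → ∃ g : GL (Fin 4) k,
        ∀ (τ : Field.absoluteGaloisGroup (v.adicCompletion ℚ)) (i j : Fin 4), j < i →
        (g * ρb.toLocal v τ * g⁻¹).val i j = 0) → ∀ (hcpt : isCompact_glFiniteIntegralLevel 4 ℚ) (ι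
        : PadicAlgCl p ≃+* ℂ), ∃ (π : CuspidalAutomorphicRepData 4 ℚ hcpt) (r : FramedGaloisRep ℚ
        (PadicAlgCl p) 4), π.1.IsRegularAlgebraic ∧
        (∀ v : HeightOneSpectrum (𝓞 ℚ), ((p : ℕ) : 𝓞 ℚ) ∈ v.asIdeal → π.1.IsUnramifiedAt v) ∧
        (∃ s : ℕ, (p - 1) ∣ s ∧ r.IsSymplecticWithMultiplierFun (fun g => algebraMap ℚ_[p]
          (PadicAlgCl p) (((((GaloisRep.cyclotomicCharacter ℚ p g)⁻¹ : ℤ_[p]ˣ) : ℤ_[p]) : ℚ_[p]) ^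
          (1 + 2 * s)))) ∧
        (∀ v : HeightOneSpectrum (𝓞 ℚ), ((p : ℕ) : 𝓞 ℚ) ∈ v.asIdeal → ∃ a : Fin 4 →
        ℕ, Function.Injective a ∧ r.IsGreenbergOrdinaryOfShapeAt v a) ∧
        (∀ᶠ v : HeightOneSpectrum (𝓞 ℚ) in Filter.cofinite,
        ∃ α : Multiset ℂ, π.1.HasSatakeParamAt v α ∧ r.IsUnramifiedAt v ∧
        r.HasFrobCharpolyAt v (arithFrobPolyOfSatake ι v.residueCard 4 α)) ∧
        (∀ᶠ v : HeightOneSpectrum (𝓞 ℚ) in Filter.cofinite, r.IsUnramifiedAt v ∧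
        ρb.IsUnramifiedAt v ∧ ∃ (P : Polynomial (Valued.integer (PadicAlgCl p))) (Pb : Polynomial
        k), r.HasFrobCharpolyAt v (P.map (Valued.integer (PadicAlgCl p)).subtype) ∧
        ρb.HasFrobCharpolyAt v Pb ∧ P.map red = Pb)) ↔
    (∃ P₀ : ℕ, ∀ (p : ℕ) [Fact p.Prime], P₀ ≤ p → ∀ (k : Type) [Field k] [CharP k p] [IsAlgClosed k]
        [TopologicalSpace k] [DiscreteTopology k] (red : Valued.integer (PadicAlgCl p) →+* k) (ρb :
        FramedGaloisRep ℚ k 4), ρb.toGaloisRep.IsIrreducible →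
        ρb.IsSymplecticWithMultiplierFun (fun g => (((Units.map (ZMod.castHom (dvd_refl p)
        k).toMonoidHom ((modularCyclotomicCharacter (AlgebraicClosure ℚ)
        (HasEnoughRootsOfUnity.natCard_rootsOfUnity (AlgebraicClosure ℚ) p)).comp
        (MulSemiringAction.toRingAut (Field.absoluteGaloisGroup ℚ) (AlgebraicClosure ℚ)) g))⁻¹ : kˣ)
        : k)) → (∀ v : HeightOneSpectrum (𝓞 ℚ), ((p : ℕ) : 𝓞 ℚ) ∈ v.asIdeal → ∃ g : GL (Fin 4) k,
        ∀ (τ : Field.absoluteGaloisGroup (v.adicCompletion ℚ)) (i j : Fin 4), j < i →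
        (g * ρb.toLocal v τ * g⁻¹).val i j = 0) → ∀ (hcpt : isCompact_glFiniteIntegralLevel 4 ℚ) (ι
        : PadicAlgCl p ≃+* ℂ), ∃ (π : CuspidalAutomorphicRepData 4 ℚ hcpt) (r : FramedGaloisRep ℚ
        (PadicAlgCl p) 4), π.1.IsRegularAlgebraic ∧
        (∀ v : HeightOneSpectrum (𝓞 ℚ), ((p : ℕ) : 𝓞 ℚ) ∈ v.asIdeal → π.1.IsUnramifiedAt v) ∧
        (∃ m : ℕ, r.IsSymplecticWithMultiplierFun (fun g => (algebraMap ℚ_[p] (PadicAlgCl p)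
          ((((GaloisRep.cyclotomicCharacter ℚ p g)⁻¹ : ℤ_[p]ˣ) : ℤ_[p]) : ℚ_[p])) ^
          (1 + 2 * (p - 1) * m))) ∧
        (∀ v : HeightOneSpectrum (𝓞 ℚ), ((p : ℕ) : 𝓞 ℚ) ∈ v.asIdeal → ∃ a : Fin 4 →
        ℕ, Function.Injective a ∧ r.IsGreenbergOrdinaryOfShapeAt v a) ∧
        (∀ᶠ v : HeightOneSpectrum (𝓞 ℚ) in Filter.cofinite,
        ∃ α : Multiset ℂ, π.1.HasSatakeParamAt v α ∧ r.IsUnramifiedAt v ∧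
        r.HasFrobCharpolyAt v (arithFrobPolyOfSatake ι v.residueCard 4 α)) ∧
        (∀ᶠ v : HeightOneSpectrum (𝓞 ℚ) in Filter.cofinite, r.IsUnramifiedAt v ∧
        ρb.IsUnramifiedAt v ∧ ∃ (P : Polynomial (Valued.integer (PadicAlgCl p))) (Pb : Polynomial
        k), r.HasFrobCharpolyAt v (P.map (Valued.integer (PadicAlgCl p)).subtype) ∧
        ρb.HasFrobCharpolyAt v Pb ∧ P.map red = Pb)) := by
  constructor
  · rintro ⟨P₀, h⟩
    refine ⟨P₀, ?_⟩
    intro p _ hp k _ _ _ _ _ red ρb hirr hsymp htri hcpt ι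
    obtain ⟨π, r, h1, h2, h3, h4, h5, h6⟩ := h p hp k red ρb hirr hsymp htri hcpt ι
    exact ⟨π, r, h1, h2, (exists_dvd_isSymplectic_cyclotomicPow_iff r).1 h3, h4, h5, h6⟩
  · rintro ⟨P₀, h⟩
    refine ⟨P₀, ?_⟩
    intro p _ hp k _ _ _ _ _ red ρb hirr hsymp htri hcpt ι
    obtain ⟨π, r, h1, h2, h3, h4, h5, h6⟩ := h p hp k red ρb hirr hsymp htri hcpt ι
    exact ⟨π, r, h1, h2, (exists_dvd_isSymplectic_cyclotomicPow_iff r).2 h3, h4, h5, h6⟩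

/-- **The corrected implication: the `## Review 2` form ↔ the Part-3 (pinned) form.** The conclusion
type of `bcgp_serreRegularWeightFixedSimilitude_implies_allAbelianSurfacesModular_of_serreRegularWeight`
(fact file) and the implication "pinned hypothesis ⟹ all abelian surfaces with irreducible `H¹`
modular" of Part 3 are equivalent (`imp_congr_left` over the previous theorem).
[cite: BoxerCalegariGeePilloni2025, Lemma 10.4.1, Rem. 10.4.2, Thm 10.2.1, Def. 1.8.12] -/
theorem serreToAbelianSurfacesFixedSimilitude_iff_pinned :
    ((∃ P₀ : ℕ, ∀ (p : ℕ) [Fact p.Prime], P₀ ≤ p → ∀ (k : Type) [Field k] [CharP k p] [IsAlgClosed k]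
        [TopologicalSpace k] [DiscreteTopology k] (red : Valued.integer (PadicAlgCl p) →+* k) (ρb :
        FramedGaloisRep ℚ k 4), ρb.toGaloisRep.IsIrreducible →
        ρb.IsSymplecticWithMultiplierFun (fun g => (((Units.map (ZMod.castHom (dvd_refl p)
        k).toMonoidHom ((modularCyclotomicCharacter (AlgebraicClosure ℚ)
        (HasEnoughRootsOfUnity.natCard_rootsOfUnity (AlgebraicClosure ℚ) p)).comp
        (MulSemiringAction.toRingAut (Field.absoluteGaloisGroup ℚ) (AlgebraicClosure ℚ)) g))⁻¹ : kˣ)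
        : k)) → (∀ v : HeightOneSpectrum (𝓞 ℚ), ((p : ℕ) : 𝓞 ℚ) ∈ v.asIdeal → ∃ g : GL (Fin 4) k,
        ∀ (τ : Field.absoluteGaloisGroup (v.adicCompletion ℚ)) (i j : Fin 4), j < i →
        (g * ρb.toLocal v τ * g⁻¹).val i j = 0) → ∀ (hcpt : isCompact_glFiniteIntegralLevel 4 ℚ) (ι
        : PadicAlgCl p ≃+* ℂ), ∃ (π : CuspidalAutomorphicRepData 4 ℚ hcpt) (r : FramedGaloisRep ℚ
        (PadicAlgCl p) 4), π.1.IsRegularAlgebraic ∧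
        (∀ v : HeightOneSpectrum (𝓞 ℚ), ((p : ℕ) : 𝓞 ℚ) ∈ v.asIdeal → π.1.IsUnramifiedAt v) ∧
        (∃ s : ℕ, (p - 1) ∣ s ∧ r.IsSymplecticWithMultiplierFun (fun g => algebraMap ℚ_[p]
          (PadicAlgCl p) (((((GaloisRep.cyclotomicCharacter ℚ p g)⁻¹ : ℤ_[p]ˣ) : ℤ_[p]) : ℚ_[p]) ^
          (1 + 2 * s)))) ∧
        (∀ v : HeightOneSpectrum (𝓞 ℚ), ((p : ℕ) : 𝓞 ℚ) ∈ v.asIdeal → ∃ a : Fin 4 →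
        ℕ, Function.Injective a ∧ r.IsGreenbergOrdinaryOfShapeAt v a) ∧
        (∀ᶠ v : HeightOneSpectrum (𝓞 ℚ) in Filter.cofinite,
        ∃ α : Multiset ℂ, π.1.HasSatakeParamAt v α ∧ r.IsUnramifiedAt v ∧
        r.HasFrobCharpolyAt v (arithFrobPolyOfSatake ι v.residueCard 4 α)) ∧
        (∀ᶠ v : HeightOneSpectrum (𝓞 ℚ) in Filter.cofinite, r.IsUnramifiedAt v ∧
        ρb.IsUnramifiedAt v ∧ ∃ (P : Polynomial (Valued.integer (PadicAlgCl p))) (Pb : Polynomial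
        k), r.HasFrobCharpolyAt v (P.map (Valued.integer (PadicAlgCl p)).subtype) ∧
        ρb.HasFrobCharpolyAt v Pb ∧ P.map red = Pb)) →
      ∀ (A : AbelianVariety ℚ), A.dim = 2 → ∀ (ℓ : ℕ) [Fact ℓ.Prime] (b : Module.Basis (Fin 4) ℚ_[ℓ]
        (A.rationalTateModule ℓ)) (r : FramedGaloisRep ℚ (PadicAlgCl ℓ) 4),
        (∀ g : Field.absoluteGaloisGroup ℚ, (r g).val = ((LinearMap.toMatrix b b (A.rationalTateRep ℓ
        g⁻¹)).map (algebraMap ℚ_[ℓ] (PadicAlgCl ℓ))).transpose) → r.toGaloisRep.IsIrreducible →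
        ∀ (hcpt : isCompact_glFiniteIntegralLevel 4 ℚ) (ι : PadicAlgCl ℓ ≃+* ℂ),
        ∃ π : CuspidalAutomorphicRepData 4 ℚ hcpt, π.1.IsLAlgebraic ∧
        ∀ᶠ v : HeightOneSpectrum (𝓞 ℚ) in Filter.cofinite,
        ∃ a : Multiset ℂ, π.1.HasSatakeParamAt v a ∧ r.IsUnramifiedAt v ∧
        r.HasFrobCharpolyAt v (arithFrobPolyOfSatake ι v.residueCard 1 a)) ↔
    ((∃ P₀ : ℕ, ∀ (p : ℕ) [Fact p.Prime], P₀ ≤ p → ∀ (k : Type) [Field k] [CharP k p] [IsAlgClosed k]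
        [TopologicalSpace k] [DiscreteTopology k] (red : Valued.integer (PadicAlgCl p) →+* k) (ρb :
        FramedGaloisRep ℚ k 4), ρb.toGaloisRep.IsIrreducible →
        ρb.IsSymplecticWithMultiplierFun (fun g => (((Units.map (ZMod.castHom (dvd_refl p)
        k).toMonoidHom ((modularCyclotomicCharacter (AlgebraicClosure ℚ)
        (HasEnoughRootsOfUnity.natCard_rootsOfUnity (AlgebraicClosure ℚ) p)).comp
        (MulSemiringAction.toRingAut (Field.absoluteGaloisGroup ℚ) (AlgebraicClosure ℚ)) g))⁻¹ : kˣ)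
        : k)) → (∀ v : HeightOneSpectrum (𝓞 ℚ), ((p : ℕ) : 𝓞 ℚ) ∈ v.asIdeal → ∃ g : GL (Fin 4) k,
        ∀ (τ : Field.absoluteGaloisGroup (v.adicCompletion ℚ)) (i j : Fin 4), j < i →
        (g * ρb.toLocal v τ * g⁻¹).val i j = 0) → ∀ (hcpt : isCompact_glFiniteIntegralLevel 4 ℚ) (ι
        : PadicAlgCl p ≃+* ℂ), ∃ (π : CuspidalAutomorphicRepData 4 ℚ hcpt) (r : FramedGaloisRep ℚ
        (PadicAlgCl p) 4), π.1.IsRegularAlgebraic ∧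
        (∀ v : HeightOneSpectrum (𝓞 ℚ), ((p : ℕ) : 𝓞 ℚ) ∈ v.asIdeal → π.1.IsUnramifiedAt v) ∧
        (∃ m : ℕ, r.IsSymplecticWithMultiplierFun (fun g => (algebraMap ℚ_[p] (PadicAlgCl p)
          ((((GaloisRep.cyclotomicCharacter ℚ p g)⁻¹ : ℤ_[p]ˣ) : ℤ_[p]) : ℚ_[p])) ^
          (1 + 2 * (p - 1) * m))) ∧
        (∀ v : HeightOneSpectrum (𝓞 ℚ), ((p : ℕ) : 𝓞 ℚ) ∈ v.asIdeal → ∃ a : Fin 4 →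
        ℕ, Function.Injective a ∧ r.IsGreenbergOrdinaryOfShapeAt v a) ∧
        (∀ᶠ v : HeightOneSpectrum (𝓞 ℚ) in Filter.cofinite,
        ∃ α : Multiset ℂ, π.1.HasSatakeParamAt v α ∧ r.IsUnramifiedAt v ∧
        r.HasFrobCharpolyAt v (arithFrobPolyOfSatake ι v.residueCard 4 α)) ∧
        (∀ᶠ v : HeightOneSpectrum (𝓞 ℚ) in Filter.cofinite, r.IsUnramifiedAt v ∧
        ρb.IsUnramifiedAt v ∧ ∃ (P : Polynomial (Valued.integer (PadicAlgCl p))) (Pb : Polynomial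
        k), r.HasFrobCharpolyAt v (P.map (Valued.integer (PadicAlgCl p)).subtype) ∧
        ρb.HasFrobCharpolyAt v Pb ∧ P.map red = Pb)) →
      ∀ (A : AbelianVariety ℚ), A.dim = 2 → ∀ (ℓ : ℕ) [Fact ℓ.Prime] (b : Module.Basis (Fin 4) ℚ_[ℓ]
        (A.rationalTateModule ℓ)) (r : FramedGaloisRep ℚ (PadicAlgCl ℓ) 4),
        (∀ g : Field.absoluteGaloisGroup ℚ, (r g).val = ((LinearMap.toMatrix b b (A.rationalTateRep ℓ
        g⁻¹)).map (algebraMap ℚ_[ℓ] (PadicAlgCl ℓ))).transpose) → r.toGaloisRep.IsIrreducible →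
        ∀ (hcpt : isCompact_glFiniteIntegralLevel 4 ℚ) (ι : PadicAlgCl ℓ ≃+* ℂ),
        ∃ π : CuspidalAutomorphicRepData 4 ℚ hcpt, π.1.IsLAlgebraic ∧
        ∀ᶠ v : HeightOneSpectrum (𝓞 ℚ) in Filter.cofinite,
        ∃ a : Multiset ℂ, π.1.HasSatakeParamAt v a ∧ r.IsUnramifiedAt v ∧
        r.HasFrobCharpolyAt v (arithFrobPolyOfSatake ι v.residueCard 1 a)) :=
  imp_congr_left ordinarySerreFixedSimilitude_iff_ordinarySerrePinned

/-- **The corrected hypothesis restricts to the wreath residues (pure logic).** Serre for `GSp₄/ℚ`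
in regular ordinary weight with fixed similitude, for ALL irreducible symplectic triangularisable
residues, implies the same for the wreath residues `Δ_p ⋊ C₂` (residually `p`-distinguished, image
of order `2p²(p-1)(p²-1)²`, irreducible on `Γ_{ℚ(ζ_p)}`, reducible on some quadratic `Γ_K`) — the
hypothesis bracket of `bcgp_serreWreathFixedSimilitude_implies_quadraticImprimitiveSurfacesModular`:
drop the extra antecedents. (Fixed-similitude twin of the route stub
`stub_serreWreath_of_ordinarySerre`.) [cite: BoxerCalegariGeePilloni2025, Lemma 10.4.1 proof (type B[C₂]), p. 146] -/
theorem serreWreathFixedSimilitude_of_ordinarySerreFixedSimilitude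
    (h : (∃ P₀ : ℕ, ∀ (p : ℕ) [Fact p.Prime], P₀ ≤ p → ∀ (k : Type) [Field k] [CharP k p] [IsAlgClosed k]
        [TopologicalSpace k] [DiscreteTopology k] (red : Valued.integer (PadicAlgCl p) →+* k) (ρb :
        FramedGaloisRep ℚ k 4), ρb.toGaloisRep.IsIrreducible →
        ρb.IsSymplecticWithMultiplierFun (fun g => (((Units.map (ZMod.castHom (dvd_refl p)
        k).toMonoidHom ((modularCyclotomicCharacter (AlgebraicClosure ℚ)
        (HasEnoughRootsOfUnity.natCard_rootsOfUnity (AlgebraicClosure ℚ) p)).comp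
        (MulSemiringAction.toRingAut (Field.absoluteGaloisGroup ℚ) (AlgebraicClosure ℚ)) g))⁻¹ : kˣ)
        : k)) → (∀ v : HeightOneSpectrum (𝓞 ℚ), ((p : ℕ) : 𝓞 ℚ) ∈ v.asIdeal → ∃ g : GL (Fin 4) k,
        ∀ (τ : Field.absoluteGaloisGroup (v.adicCompletion ℚ)) (i j : Fin 4), j < i →
        (g * ρb.toLocal v τ * g⁻¹).val i j = 0) → ∀ (hcpt : isCompact_glFiniteIntegralLevel 4 ℚ) (ι
        : PadicAlgCl p ≃+* ℂ), ∃ (π : CuspidalAutomorphicRepData 4 ℚ hcpt) (r : FramedGaloisRep ℚ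
        (PadicAlgCl p) 4), π.1.IsRegularAlgebraic ∧
        (∀ v : HeightOneSpectrum (𝓞 ℚ), ((p : ℕ) : 𝓞 ℚ) ∈ v.asIdeal → π.1.IsUnramifiedAt v) ∧
        (∃ s : ℕ, (p - 1) ∣ s ∧ r.IsSymplecticWithMultiplierFun (fun g => algebraMap ℚ_[p]
          (PadicAlgCl p) (((((GaloisRep.cyclotomicCharacter ℚ p g)⁻¹ : ℤ_[p]ˣ) : ℤ_[p]) : ℚ_[p]) ^
          (1 + 2 * s)))) ∧
        (∀ v : HeightOneSpectrum (𝓞 ℚ), ((p : ℕ) : 𝓞 ℚ) ∈ v.asIdeal → ∃ a : Fin 4 →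
        ℕ, Function.Injective a ∧ r.IsGreenbergOrdinaryOfShapeAt v a) ∧
        (∀ᶠ v : HeightOneSpectrum (𝓞 ℚ) in Filter.cofinite,
        ∃ α : Multiset ℂ, π.1.HasSatakeParamAt v α ∧ r.IsUnramifiedAt v ∧
        r.HasFrobCharpolyAt v (arithFrobPolyOfSatake ι v.residueCard 4 α)) ∧
        (∀ᶠ v : HeightOneSpectrum (𝓞 ℚ) in Filter.cofinite, r.IsUnramifiedAt v ∧
        ρb.IsUnramifiedAt v ∧ ∃ (P : Polynomial (Valued.integer (PadicAlgCl p))) (Pb : Polynomial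
        k), r.HasFrobCharpolyAt v (P.map (Valued.integer (PadicAlgCl p)).subtype) ∧
        ρb.HasFrobCharpolyAt v Pb ∧ P.map red = Pb))) :
    (∃ P₀ : ℕ, ∀ (p : ℕ) [Fact p.Prime], P₀ ≤ p → ∀ (k : Type) [Field k] [CharP k p] [IsAlgClosed k]
        [TopologicalSpace k] [DiscreteTopology k] (red : Valued.integer (PadicAlgCl p) →+* k) (ρb :
        FramedGaloisRep ℚ k 4), ρb.toGaloisRep.IsIrreducible →
        ρb.IsSymplecticWithMultiplierFun (fun g => (((Units.map (ZMod.castHom (dvd_refl p)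
        k).toMonoidHom ((modularCyclotomicCharacter (AlgebraicClosure ℚ)
        (HasEnoughRootsOfUnity.natCard_rootsOfUnity (AlgebraicClosure ℚ) p)).comp
        (MulSemiringAction.toRingAut (Field.absoluteGaloisGroup ℚ) (AlgebraicClosure ℚ)) g))⁻¹ : kˣ)
        : k)) → (∀ v : HeightOneSpectrum (𝓞 ℚ), ((p : ℕ) : 𝓞 ℚ) ∈ v.asIdeal → ∃ g : GL (Fin 4) k,
        (∀ (τ : Field.absoluteGaloisGroup (v.adicCompletion ℚ)) (i j : Fin 4), j < i →
        (g * ρb.toLocal v τ * g⁻¹).val i j = 0) ∧ ∀ i j : Fin 4, i ≠ j →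
        ∃ τ : Field.absoluteGaloisGroup (v.adicCompletion ℚ),
        (g * ρb.toLocal v τ * g⁻¹).val i i ≠ (g * ρb.toLocal v τ * g⁻¹).val j j) →
        Nat.card ρb.toMonoidHom.range = 2 * p ^ 2 * (p - 1) * (p ^ 2 - 1) ^ 2 →
        (ρb.restrictField (CyclotomicField p ℚ)).toGaloisRep.IsIrreducible →
        (∃ (K : Type) (_ : Field K) (_ : NumberField K), Module.finrank ℚ K = 2 ∧
          ¬ (ρb.restrictField K).toGaloisRep.IsIrreducible) → ∀ (hcpt : isCompact_glFiniteIntegralLevel 4 ℚ) (ι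
        : PadicAlgCl p ≃+* ℂ), ∃ (π : CuspidalAutomorphicRepData 4 ℚ hcpt) (r : FramedGaloisRep ℚ
        (PadicAlgCl p) 4), π.1.IsRegularAlgebraic ∧
        (∀ v : HeightOneSpectrum (𝓞 ℚ), ((p : ℕ) : 𝓞 ℚ) ∈ v.asIdeal → π.1.IsUnramifiedAt v) ∧
        (∃ s : ℕ, (p - 1) ∣ s ∧ r.IsSymplecticWithMultiplierFun (fun g => algebraMap ℚ_[p]
          (PadicAlgCl p) (((((GaloisRep.cyclotomicCharacter ℚ p g)⁻¹ : ℤ_[p]ˣ) : ℤ_[p]) : ℚ_[p]) ^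
          (1 + 2 * s)))) ∧
        (∀ v : HeightOneSpectrum (𝓞 ℚ), ((p : ℕ) : 𝓞 ℚ) ∈ v.asIdeal → ∃ a : Fin 4 →
        ℕ, Function.Injective a ∧ r.IsGreenbergOrdinaryOfShapeAt v a) ∧
        (∀ᶠ v : HeightOneSpectrum (𝓞 ℚ) in Filter.cofinite,
        ∃ α : Multiset ℂ, π.1.HasSatakeParamAt v α ∧ r.IsUnramifiedAt v ∧
        r.HasFrobCharpolyAt v (arithFrobPolyOfSatake ι v.residueCard 4 α)) ∧
        (∀ᶠ v : HeightOneSpectrum (𝓞 ℚ) in Filter.cofinite, r.IsUnramifiedAt v ∧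
        ρb.IsUnramifiedAt v ∧ ∃ (P : Polynomial (Valued.integer (PadicAlgCl p))) (Pb : Polynomial
        k), r.HasFrobCharpolyAt v (P.map (Valued.integer (PadicAlgCl p)).subtype) ∧
        ρb.HasFrobCharpolyAt v Pb ∧ P.map red = Pb)) := by
  obtain ⟨P₀, h⟩ := h
  refine ⟨P₀, ?_⟩
  intro p _ hp k _ _ _ _ _ red ρb hirr hsymp htri _hcard _hcyc _hK hcpt ι
  exact h p hp k red ρb hirr hsymp (fun v hv => (htri v hv).imp fun g hg => hg.1) hcpt ι

/-- **Corrected implication = (corrected wreath fact) ⊕ (primitive slice).** GRANTED the named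
corrected wreath fact `bcgp_serreWreathFixedSimilitude_implies_quadraticImprimitiveSurfacesModular`
(BCGP 2025 Lemma 10.4.1 along its proof for Galois type **B**[C₂], p. 146, similitude fixed, +
Theorem 10.2.1 + Faltings; unproved in the tree) and the quadratically PRIMITIVE slice of the
corrected implication — its fixed-similitude hypothesis bracket VERBATIM ⟹ modularity of the abelian
surfaces `A/ℚ` whose framed dual `H¹ ⊗ ℚ̄_ℓ` is irreducible and stays irreducible over every
quadratic field (proof of Lemma 10.4.1 for type **A**, p. 146, + Theorem 10.2.1 for the remaining
primitive types; stated inline as `hP`, no definition) —, the corrected implication (conclusion type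
of `bcgp_serreRegularWeightFixedSimilitude_implies_allAbelianSurfacesModular_of_serreRegularWeight`)
follows, exactly as in Part 2: split on quadratic imprimitivity of `r`; imprimitive ⟹ `End_ℚ(A) =
ℤ · 𝟙` by the Faltings-free `AbelianVariety.forall_end_eq_zsmul_id_of_isIrreducible_dualFrame`
(Part 1; Mumford §19 Thm. 3 + Schur), restrict the hypothesis to the wreath residues
(`serreWreathFixedSimilitude_of_ordinarySerreFixedSimilitude`) and apply the wreath fact; primitive
⟹ `hP`. [cite: BoxerCalegariGeePilloni2025, Lemma 10.4.1, Rem. 10.4.2, proof p. 146; Thm 10.2.1; Def. 1.8.12; §1.8.9]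
[cite: MumfordAV1970, §19 Thm. 3 and Cor. 1] -/
theorem bcgp_serreRegularWeightFixedSimilitude_of_wreathFixedSimilitude_of_primitive
    (hW : bcgp_serreWreathFixedSimilitude_implies_quadraticImprimitiveSurfacesModular)
    (hP : (∃ P₀ : ℕ, ∀ (p : ℕ) [Fact p.Prime], P₀ ≤ p → ∀ (k : Type) [Field k] [CharP k p] [IsAlgClosed k]
        [TopologicalSpace k] [DiscreteTopology k] (red : Valued.integer (PadicAlgCl p) →+* k) (ρb :
        FramedGaloisRep ℚ k 4), ρb.toGaloisRep.IsIrreducible →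
        ρb.IsSymplecticWithMultiplierFun (fun g => (((Units.map (ZMod.castHom (dvd_refl p)
        k).toMonoidHom ((modularCyclotomicCharacter (AlgebraicClosure ℚ)
        (HasEnoughRootsOfUnity.natCard_rootsOfUnity (AlgebraicClosure ℚ) p)).comp
        (MulSemiringAction.toRingAut (Field.absoluteGaloisGroup ℚ) (AlgebraicClosure ℚ)) g))⁻¹ : kˣ)
        : k)) → (∀ v : HeightOneSpectrum (𝓞 ℚ), ((p : ℕ) : 𝓞 ℚ) ∈ v.asIdeal → ∃ g : GL (Fin 4) k,
        ∀ (τ : Field.absoluteGaloisGroup (v.adicCompletion ℚ)) (i j : Fin 4), j < i →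
        (g * ρb.toLocal v τ * g⁻¹).val i j = 0) → ∀ (hcpt : isCompact_glFiniteIntegralLevel 4 ℚ) (ι
        : PadicAlgCl p ≃+* ℂ), ∃ (π : CuspidalAutomorphicRepData 4 ℚ hcpt) (r : FramedGaloisRep ℚ
        (PadicAlgCl p) 4), π.1.IsRegularAlgebraic ∧
        (∀ v : HeightOneSpectrum (𝓞 ℚ), ((p : ℕ) : 𝓞 ℚ) ∈ v.asIdeal → π.1.IsUnramifiedAt v) ∧
        (∃ s : ℕ, (p - 1) ∣ s ∧ r.IsSymplecticWithMultiplierFun (fun g => algebraMap ℚ_[p]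
          (PadicAlgCl p) (((((GaloisRep.cyclotomicCharacter ℚ p g)⁻¹ : ℤ_[p]ˣ) : ℤ_[p]) : ℚ_[p]) ^
          (1 + 2 * s)))) ∧
        (∀ v : HeightOneSpectrum (𝓞 ℚ), ((p : ℕ) : 𝓞 ℚ) ∈ v.asIdeal → ∃ a : Fin 4 →
        ℕ, Function.Injective a ∧ r.IsGreenbergOrdinaryOfShapeAt v a) ∧
        (∀ᶠ v : HeightOneSpectrum (𝓞 ℚ) in Filter.cofinite,
        ∃ α : Multiset ℂ, π.1.HasSatakeParamAt v α ∧ r.IsUnramifiedAt v ∧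
        r.HasFrobCharpolyAt v (arithFrobPolyOfSatake ι v.residueCard 4 α)) ∧
        (∀ᶠ v : HeightOneSpectrum (𝓞 ℚ) in Filter.cofinite, r.IsUnramifiedAt v ∧
        ρb.IsUnramifiedAt v ∧ ∃ (P : Polynomial (Valued.integer (PadicAlgCl p))) (Pb : Polynomial
        k), r.HasFrobCharpolyAt v (P.map (Valued.integer (PadicAlgCl p)).subtype) ∧
        ρb.HasFrobCharpolyAt v Pb ∧ P.map red = Pb)) →
      ∀ (A : AbelianVariety ℚ), A.dim = 2 → ∀ (ℓ : ℕ) [Fact ℓ.Prime] (b : Module.Basis (Fin 4) ℚ_[ℓ]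
        (A.rationalTateModule ℓ)) (r : FramedGaloisRep ℚ (PadicAlgCl ℓ) 4),
        (∀ g : Field.absoluteGaloisGroup ℚ, (r g).val = ((LinearMap.toMatrix b b (A.rationalTateRep ℓ
        g⁻¹)).map (algebraMap ℚ_[ℓ] (PadicAlgCl ℓ))).transpose) → r.toGaloisRep.IsIrreducible →
        (∀ (K : Type) [Field K] [NumberField K], Module.finrank ℚ K = 2 →
          FramedRep.IsIrreducible (r.restrictField K)) →
        ∀ (hcpt : isCompact_glFiniteIntegralLevel 4 ℚ) (ι : PadicAlgCl ℓ ≃+* ℂ),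
        ∃ π : CuspidalAutomorphicRepData 4 ℚ hcpt, π.1.IsLAlgebraic ∧
        ∀ᶠ v : HeightOneSpectrum (𝓞 ℚ) in Filter.cofinite,
        ∃ a : Multiset ℂ, π.1.HasSatakeParamAt v a ∧ r.IsUnramifiedAt v ∧
        r.HasFrobCharpolyAt v (arithFrobPolyOfSatake ι v.residueCard 1 a)) :
    (∃ P₀ : ℕ, ∀ (p : ℕ) [Fact p.Prime], P₀ ≤ p → ∀ (k : Type) [Field k] [CharP k p] [IsAlgClosed k]
        [TopologicalSpace k] [DiscreteTopology k] (red : Valued.integer (PadicAlgCl p) →+* k) (ρb :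
        FramedGaloisRep ℚ k 4), ρb.toGaloisRep.IsIrreducible →
        ρb.IsSymplecticWithMultiplierFun (fun g => (((Units.map (ZMod.castHom (dvd_refl p)
        k).toMonoidHom ((modularCyclotomicCharacter (AlgebraicClosure ℚ)
        (HasEnoughRootsOfUnity.natCard_rootsOfUnity (AlgebraicClosure ℚ) p)).comp
        (MulSemiringAction.toRingAut (Field.absoluteGaloisGroup ℚ) (AlgebraicClosure ℚ)) g))⁻¹ : kˣ)
        : k)) → (∀ v : HeightOneSpectrum (𝓞 ℚ), ((p : ℕ) : 𝓞 ℚ) ∈ v.asIdeal → ∃ g : GL (Fin 4) k,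
        ∀ (τ : Field.absoluteGaloisGroup (v.adicCompletion ℚ)) (i j : Fin 4), j < i →
        (g * ρb.toLocal v τ * g⁻¹).val i j = 0) → ∀ (hcpt : isCompact_glFiniteIntegralLevel 4 ℚ) (ι
        : PadicAlgCl p ≃+* ℂ), ∃ (π : CuspidalAutomorphicRepData 4 ℚ hcpt) (r : FramedGaloisRep ℚ
        (PadicAlgCl p) 4), π.1.IsRegularAlgebraic ∧
        (∀ v : HeightOneSpectrum (𝓞 ℚ), ((p : ℕ) : 𝓞 ℚ) ∈ v.asIdeal → π.1.IsUnramifiedAt v) ∧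
        (∃ s : ℕ, (p - 1) ∣ s ∧ r.IsSymplecticWithMultiplierFun (fun g => algebraMap ℚ_[p]
          (PadicAlgCl p) (((((GaloisRep.cyclotomicCharacter ℚ p g)⁻¹ : ℤ_[p]ˣ) : ℤ_[p]) : ℚ_[p]) ^
          (1 + 2 * s)))) ∧
        (∀ v : HeightOneSpectrum (𝓞 ℚ), ((p : ℕ) : 𝓞 ℚ) ∈ v.asIdeal → ∃ a : Fin 4 →
        ℕ, Function.Injective a ∧ r.IsGreenbergOrdinaryOfShapeAt v a) ∧
        (∀ᶠ v : HeightOneSpectrum (𝓞 ℚ) in Filter.cofinite,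
        ∃ α : Multiset ℂ, π.1.HasSatakeParamAt v α ∧ r.IsUnramifiedAt v ∧
        r.HasFrobCharpolyAt v (arithFrobPolyOfSatake ι v.residueCard 4 α)) ∧
        (∀ᶠ v : HeightOneSpectrum (𝓞 ℚ) in Filter.cofinite, r.IsUnramifiedAt v ∧
        ρb.IsUnramifiedAt v ∧ ∃ (P : Polynomial (Valued.integer (PadicAlgCl p))) (Pb : Polynomial
        k), r.HasFrobCharpolyAt v (P.map (Valued.integer (PadicAlgCl p)).subtype) ∧
        ρb.HasFrobCharpolyAt v Pb ∧ P.map red = Pb)) →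
      ∀ (A : AbelianVariety ℚ), A.dim = 2 → ∀ (ℓ : ℕ) [Fact ℓ.Prime] (b : Module.Basis (Fin 4) ℚ_[ℓ]
        (A.rationalTateModule ℓ)) (r : FramedGaloisRep ℚ (PadicAlgCl ℓ) 4),
        (∀ g : Field.absoluteGaloisGroup ℚ, (r g).val = ((LinearMap.toMatrix b b (A.rationalTateRep ℓ
        g⁻¹)).map (algebraMap ℚ_[ℓ] (PadicAlgCl ℓ))).transpose) → r.toGaloisRep.IsIrreducible →
        ∀ (hcpt : isCompact_glFiniteIntegralLevel 4 ℚ) (ι : PadicAlgCl ℓ ≃+* ℂ),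
        ∃ π : CuspidalAutomorphicRepData 4 ℚ hcpt, π.1.IsLAlgebraic ∧
        ∀ᶠ v : HeightOneSpectrum (𝓞 ℚ) in Filter.cofinite,
        ∃ a : Multiset ℂ, π.1.HasSatakeParamAt v a ∧ r.IsUnramifiedAt v ∧
        r.HasFrobCharpolyAt v (arithFrobPolyOfSatake ι v.residueCard 1 a) := by
  intro hH A hA ℓ _ b r hr hirr hcpt ι
  by_cases himp : ∃ (K : Type) (_ : Field K) (_ : NumberField K), Module.finrank ℚ K = 2 ∧
      ¬ FramedRep.IsIrreducible (r.restrictField K)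
  · -- imprimitive: `End_ℚ(A) = ℤ` by Part 1, then the corrected wreath fact
    have hEnd : ∀ f : A ⟶ A, ∃ n : ℤ, f = n • 𝟙 A :=
      A.forall_end_eq_zsmul_id_of_isIrreducible_dualFrame ℓ
        (Nat.cast_ne_zero.2 (Fact.out : ℓ.Prime).ne_zero) b r hr hirr
    exact hW (serreWreathFixedSimilitude_of_ordinarySerreFixedSimilitude hH) A hA hEnd ℓ b r hr himp
      hcpt ι
  · -- primitive: the primitive slice
    have hprim : ∀ (K : Type) [Field K] [NumberField K], Module.finrank ℚ K = 2 →
        FramedRep.IsIrreducible (r.restrictField K) := fun K hF hNF hK => by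
      by_contra hc
      exact himp ⟨K, hF, hNF, hK, hc⟩
    exact hP hH A hA ℓ b r hr hirr hprim hcpt ι

end Literature.NumberTheory.DiophantineGeometry
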